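import Mathlib
import Literature.MathematicalPhysics.QuantumLattice.GaugeGroups
import Literature.MathematicalPhysics.QuantumLattice.HeatKernelGroupGaugeProofs
import HarnessLib

/-!
# The Wilson flow (Lüscher's lattice gradient flow) of `SU(n)` lattice gauge fields

Definition request `defn-wilsonFlow` (topic `Literature/MathematicalPhysics/QuantumFieldTheory`), next to
`GaugeConfig` / `plaquetteHolonomy` / `wilsonAction` of `ConstructiveQFTWave0.lean`.

## Informal content

For a gauge configuration `U : GaugeConfig d L SU(n)` on the discrete torus `(ℤ/Lℤ)^d`, the *Wilson flow*
`V_t = wilsonFlow t U` is the solution of Lüscher's flow equation [Luscher2010, eqs. (1.3)–(1.4)]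

  `d/dt V_t(x,μ) = −g₀² {∂_{x,μ} S_w(V_t)} V_t(x,μ)`, `V_0 = U`,

where `S_w(U) = g₀⁻² ∑_{oriented p} Re tr (1 − U(p))` is the Wilson plaquette action summed over ORIENTED
plaquettes and `∂_{x,μ} = T^a ∂^a_{x,μ}` is the `𝔰𝔲(n)`-valued left-invariant link derivative,
`∂^a_{x,μ} f(U) = d/ds f(e^{sT^a} U(x,μ))|_{s=0}`, `tr T^aT^b = −½ δ^{ab}` [Luscher2010, App. A, (A.2)–(A.4)].
Evaluating the derivative gives the explicit form used here,

  `g₀² ∂_{x,μ} S_w(V) = P(Ω_{x,μ}(V))`, `P(W) = ½ (W − Wᴴ) − (1/(2n)) tr(W − Wᴴ) · 1`,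

`Ω_{x,μ}(V)` = the sum, over the `2(d−1)` plaquettes containing the link `(x,μ)`, of the plaquette holonomy
oriented so as to START with `V(x,μ)`, and `P` = the projection onto traceless anti-Hermitian matrices. In this
form the flow is the infinitesimal version of stout-link smearing [MorningstarPeardon2004, eqs. (1)–(3)]:
with their `C_μ(x)` = staple sum, `Ω^{MP}_μ = C_μ U_μ† = Ω_{x,μ}ᴴ` and `Q_μ = (i/2)(Ω^{MP}ᴴ − Ω^{MP}) −
(i/2n) tr(Ω^{MP}ᴴ − Ω^{MP}) = i P(Ω_{x,μ})`, one stout step is `U ↦ e^{iQ} U = e^{−P(Ω)} U`, and Lüscher notes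
that the Wilson flow "is generated by infinitesimal stout link smearing steps" [Luscher2010, §1]. (Sign check,
abelian one-plaquette toy: `φ̇ = −sin θ`, the gradient descent of `1 − cos θ`.) Flow time is in lattice units
(`t/a²` in physical units), Lüscher's normalisation.

"The existence, uniqueness and smoothness of the Wilson flow at all positive and negative times `t` is
rigorously guaranteed on a finite lattice. Moreover … the action `S_w(V_t)` is a monotonically decreasing
function of `t`" [Luscher2010, §1, after (1.4)]; "the flow equation has a unique solution for any specified
initial value and all `t ∈ (−∞, ∞)` … because the field manifold is compact" [Luscher2010Trivializing, §3.2];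
`d/dt S_w(V_t) ≤ 0` [Luscher2010Trivializing, eq. (4.30)].

## Contents (all proved; no named facts)

* `suProj W` — the projection `P`; `plaquetteLoopSum V x μ` — `Ω_{x,μ}(V)` (literally the inline expression used
  by the route `GradientFlowSpecies`); `wilsonFlowVF V e = −P(Ω_e(V)) · V(e)` — the flow vector field.
* `IsWilsonFlowLine U V` — `V : ℝ → GaugeConfig` is a global (two-sided) solution through `U`;
  `IsWilsonFlowSolution B` — the route's predicate on a family `B : ℝ → GaugeConfig → GaugeConfig`
  (initial condition and the ODE entrywise at all `τ ≥ 0`).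
* `wilsonFlow t U` — THE definition: the value at time `t` of the unique global flow line through `U`.
* API: `wilsonFlow_zero`; `hasDerivAt_wilsonFlow` (the ODE at every `t ∈ ℝ`);
  `isWilsonFlowLine_wilsonFlow`, `IsWilsonFlowLine.eq_wilsonFlow`, `IsWilsonFlowLine.unique` (global existence and
  uniqueness); `isWilsonFlowSolution_wilsonFlow`, `IsWilsonFlowSolution.eq_wilsonFlow` (the route predicate holds,
  and any family satisfying it agrees with `wilsonFlow` at `t ≥ 0`), `suProj_fin_three` (`1/(2·3) = 1/6`);
  `wilsonFlow_add`, `wilsonFlow_neg_wilsonFlow` (group law `V_{s+t} = V_s ∘ V_t`); `wilsonFlow_gaugeTransform`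
  (gauge covariance); `GaugeConfig.siteTranslate`, `wilsonFlow_siteTranslate` (translation covariance);
  `continuous_wilsonFlow`, `measurable_wilsonFlow`, `continuous_wilsonFlow_uncurry`, `continuous_wilsonFlow_apply`;
  `hasDerivAt_wilsonAction_wilsonFlow`, `deriv_wilsonAction_wilsonFlow_nonpos`, `antitone_wilsonAction_wilsonFlow`,
  `wilsonAction_wilsonFlow_le` (`d/dt S_W(V_t) = −∑_e Re tr (P_eᴴ P_e) ≤ 0`);
  `wilsonFlow_eq_self_of_wilsonFlowVF_eq_zero`, `wilsonFlow_eq_self_of_flat` (zeros of the vector field, e.g. flat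
  configurations, are stationary).

## Design choices

* Everything is for `G = SU(n) = Matrix.specialUnitaryGroup (Fin n) ℂ` (instances from
  `QuantumLattice/GaugeGroups.lean`), general `d`, `L`, `n`; the route uses `d = 4`, `n = 3`.
* Public statements are instance-free: derivatives are stated ENTRYWISE (`HasDerivAt` of
  `s ↦ (V s e : Matrix) i j : ℝ → ℂ`), exactly as the route's inline predicate. The proofs work in the ambient
  space `Edge d L → Matrix (Fin n) (Fin n) ℂ` with the Frobenius norm (`open scoped Matrix.Norms.Frobenius`):
  Picard–Lindelöf (`IsPicardLindelof`) for a compactly cut-off `C¹` extension of the vector field, invariance of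
  `SU(n)^E` (`d/dt VᴴV = 0` by skew-Hermiticity, `d/dt det V = −tr P · det V = 0` by Liouville's formula,
  proved here from the Leibniz expansion), Grönwall uniqueness (`ODE_solution_unique_univ`).
* `wilsonFlow` is defined by `Classical.choose` on the (proved) existence of a global flow line, guarded by a
  `dite` so that `wilsonFlow 0 U = U` holds unconditionally; uniqueness makes the choice irrelevant. No `[NeZero L]`
  is needed to state the definition; all analytic theorems assume `[NeZero L]` (finite torus).
* Relation to the tree's `wilsonAction ρ` (sum over UNORIENTED plaquettes, `ρ = fundamentalRep`): Lüscher's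
  `g₀² S_w = 2 · wilsonAction`, and the flow is the gradient flow of `2 · wilsonAction` for the inner product
  `⟨X, Y⟩ = −2 ∑_e Re tr (X_e Y_e)` on `𝔰𝔲(n)^E`; we prove the consequence that matters,
  `d/dt wilsonAction (V_t) = −∑_e Re tr (P_eᴴ P_e)`.
* Not here: the fermion ("quark") flow (`defn-fermionFlow`), perturbative properties (LuscherWeisz2011),
  `t → ∞` asymptotics, covariance under lattice rotations/reflections (only translations and gauge
  transformations are proved).
-/

noncomputable section

open Matrix Set Metric Filter Function
open scoped Matrix Topology NNReal BigOperators

namespace Literature.MathematicalPhysics.QuantumFieldTheory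

/-- Local notation for the special unitary group `SU(n) ⊆ M_n(ℂ)` (Mathlib's `Matrix.specialUnitaryGroup`). [folklore] -/
local notation "SU[" n "]" => Matrix.specialUnitaryGroup (Fin n) ℂ

variable {d L n : ℕ}

/-! ## The projection onto `𝔰𝔲(n)` -/

section SuProj

/-- The projection `P(W) = ½ (W − Wᴴ) − (1/(2n)) tr(W − Wᴴ) · 1` of an `n × n` complex matrix onto the traceless
anti-Hermitian matrices `𝔰𝔲(n)` (orthogonal for `⟨A, B⟩ = Re tr(Aᴴ B)`); this is `g₀² ∂_{x,μ} S_w` evaluated on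
`W = Ω_{x,μ}` [Luscher2010, (1.4), (A.2)–(A.4)], and `−i Q_μ(x)` of Morningstar–Peardon with `Ω^{MP} = Wᴴ`
[cite: MorningstarPeardon2004, eq. (2)]. -/
def suProj (W : Matrix (Fin n) (Fin n) ℂ) : Matrix (Fin n) (Fin n) ℂ :=
  (1 / 2 : ℂ) • (W - Wᴴ) - ((1 / (2 * n) : ℂ) * (W - Wᴴ).trace) • (1 : Matrix (Fin n) (Fin n) ℂ)

/-- Unfolding lemma for `suProj`. [folklore] -/
theorem suProj_def (W : Matrix (Fin n) (Fin n) ℂ) :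
    suProj W = (1 / 2 : ℂ) • (W - Wᴴ) - ((1 / (2 * n) : ℂ) * (W - Wᴴ).trace) • 1 := rfl

/-- The trace of `W − Wᴴ` is purely imaginary: `star (tr (W − Wᴴ)) = −tr (W − Wᴴ)`. [folklore] -/
theorem star_trace_sub_conjTranspose (W : Matrix (Fin n) (Fin n) ℂ) :
    star (W - Wᴴ).trace = -(W - Wᴴ).trace := by
  rw [← Matrix.trace_conjTranspose, Matrix.conjTranspose_sub, Matrix.conjTranspose_conjTranspose,
    ← Matrix.trace_neg, neg_sub]

/-- `P(W)` is anti-Hermitian: `P(W)ᴴ = −P(W)` [cite: MorningstarPeardon2004, eq. (2)]. -/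
theorem conjTranspose_suProj (W : Matrix (Fin n) (Fin n) ℂ) : (suProj W)ᴴ = -suProj W := by
  have h2 : (star (1 / 2 : ℂ)) = 1 / 2 := by norm_num [Complex.ext_iff]
  have hc : star (1 / (2 * n) : ℂ) = 1 / (2 * n) := by simp
  simp only [suProj, Matrix.conjTranspose_sub, Matrix.conjTranspose_smul, Matrix.conjTranspose_conjTranspose,
    Matrix.conjTranspose_one, star_mul', star_trace_sub_conjTranspose, h2, hc, neg_sub]
  rw [smul_sub, smul_sub, mul_neg, neg_smul]
  abel

/-- `P(W)` is traceless [cite: MorningstarPeardon2004, eq. (2)]. -/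
theorem trace_suProj (W : Matrix (Fin n) (Fin n) ℂ) : (suProj W).trace = 0 := by
  rcases Nat.eq_zero_or_pos n with hn | hn
  · subst hn
    simp [Matrix.trace]
  · have hn' : (n : ℂ) ≠ 0 := by exact_mod_cast hn.ne'
    simp only [suProj, Matrix.trace_sub, Matrix.trace_smul, Matrix.trace_one, Fintype.card_fin, smul_eq_mul]
    field_simp
    ring

/-- `P` fixes `𝔰𝔲(n)`: if `Wᴴ = −W` and `tr W = 0` then `P(W) = W`. [folklore] -/
theorem suProj_eq_self {W : Matrix (Fin n) (Fin n) ℂ} (hW : Wᴴ = -W) (htr : W.trace = 0) : suProj W = W := by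
  simp only [suProj, hW, sub_neg_eq_add, Matrix.trace_add, htr, add_zero, mul_zero, zero_smul, sub_zero]
  rw [← two_smul ℂ W, smul_smul]
  norm_num

/-- `P` is idempotent. [folklore] -/
theorem suProj_suProj (W : Matrix (Fin n) (Fin n) ℂ) : suProj (suProj W) = suProj W :=
  suProj_eq_self (conjTranspose_suProj W) (trace_suProj W)

/-- `P(0) = 0`. [folklore] -/
@[simp] theorem suProj_zero : suProj (0 : Matrix (Fin n) (Fin n) ℂ) = 0 := by
  simp [suProj]

/-- For `n = 3` the coefficient `1/(2n)` is the route's literal `1/6`. [folklore] -/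
theorem suProj_fin_three (W : Matrix (Fin 3) (Fin 3) ℂ) :
    suProj W = (1 / 2 : ℂ) • (W - Wᴴ) - ((1 / 6 : ℂ) * (W - Wᴴ).trace) • (1 : Matrix (Fin 3) (Fin 3) ℂ) := by
  rw [suProj]
  norm_num

/-- Covariance of `P` under unitary conjugation: `P(g W g⁻¹) = g P(W) g⁻¹` for `g ∈ U(n)`. [folklore] -/
theorem suProj_unitary_conj {g : Matrix (Fin n) (Fin n) ℂ} (hg : g ∈ Matrix.unitaryGroup (Fin n) ℂ)
    (W : Matrix (Fin n) (Fin n) ℂ) : suProj (g * W * star g) = g * suProj W * star g := by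
  have h1 : g * star g = 1 := Matrix.mem_unitaryGroup_iff.mp hg
  have h2 : star g * g = 1 := Matrix.mem_unitaryGroup_iff'.mp hg
  have hconj : (g * W * star g)ᴴ = g * Wᴴ * star g := by
    simp only [Matrix.conjTranspose_mul, Matrix.star_eq_conjTranspose, Matrix.conjTranspose_conjTranspose,
      Matrix.mul_assoc]
  have hX : g * W * star g - (g * W * star g)ᴴ = g * (W - Wᴴ) * star g := by
    rw [hconj, Matrix.mul_sub, Matrix.sub_mul]
  have htr : (g * (W - Wᴴ) * star g).trace = (W - Wᴴ).trace := by
    rw [Matrix.trace_mul_cycle, h2, Matrix.one_mul]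
  calc suProj (g * W * star g)
      = (1 / 2 : ℂ) • (g * (W - Wᴴ) * star g) - ((1 / (2 * n) : ℂ) * (W - Wᴴ).trace) • 1 := by
        rw [suProj, hX, htr]
    _ = g * suProj W * star g := by
        simp only [suProj, Matrix.mul_sub, Matrix.sub_mul, Matrix.mul_smul, Matrix.smul_mul, Matrix.mul_one, h1]

end SuProj

/-! ## The flow vector field on `SU(n)` configurations -/

section VectorField

/-- `Ω_{x,μ}(V)`: the sum over the `2(d−1)` plaquettes containing the link `(x, μ)` of the plaquette holonomy
oriented so as to start with `V(x,μ)` — for each `ν ≠ μ` the "upper" plaquette `V(x,μ)V(x+μ̂,ν)V(x+ν̂,μ)⁻¹V(x,ν)⁻¹`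
and the "lower" one `V(x,μ)V(x−ν̂+μ̂,ν)⁻¹V(x−ν̂,μ)⁻¹V(x−ν̂,ν)`, the latter written as the conjugate
`V(x−ν̂,ν)⁻¹ · plaquetteHolonomy V (x−ν̂) ν μ · V(x−ν̂,ν)` — as an `n × n` matrix. This is LITERALLY the inline
expression of items `FlowedEnergyUVBound` / `LatticeFlowEpsilonRegularity` of route `GradientFlowSpecies`.
It is the Hermitian conjugate of Morningstar–Peardon's `Ω_μ(x) = C_μ(x) U_μ(x)†` with unit staple weights
[cite: MorningstarPeardon2004, eqs. (1)–(2)]. -/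
def plaquetteLoopSum (V : GaugeConfig d L SU[n]) (x : Site d L) (μ : Fin d) : Matrix (Fin n) (Fin n) ℂ :=
  ∑ ν : Fin d, if ν = μ then (0 : Matrix (Fin n) (Fin n) ℂ) else
    (((plaquetteHolonomy V x μ ν : SU[n]) : Matrix (Fin n) (Fin n) ℂ) +
      (((V (x - Pi.single ν 1, ν))⁻¹ * plaquetteHolonomy V (x - Pi.single ν 1) ν μ * V (x - Pi.single ν 1, ν) :
        SU[n]) : Matrix (Fin n) (Fin n) ℂ))

/-- The Wilson-flow vector field `Z(V)(x,μ) = −P(Ω_{x,μ}(V)) · V(x,μ)` (an `n × n` matrix, the velocity of the link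
variable `V(x,μ)` in the ambient matrix space): the right-hand side of Lüscher's flow equation
`V̇ = −g₀² {∂_{x,μ} S_w(V)} V` [cite: Luscher2010, eq. (1.4)]. -/
def wilsonFlowVF (V : GaugeConfig d L SU[n]) (e : Edge d L) : Matrix (Fin n) (Fin n) ℂ :=
  -suProj (plaquetteLoopSum V e.1 e.2) * ((V e : SU[n]) : Matrix (Fin n) (Fin n) ℂ)

/-- Unfolding lemma for `wilsonFlowVF`. [folklore] -/
theorem wilsonFlowVF_apply (V : GaugeConfig d L SU[n]) (x : Site d L) (μ : Fin d) :
    wilsonFlowVF V (x, μ) = -suProj (plaquetteLoopSum V x μ) * ((V (x, μ) : SU[n]) : Matrix (Fin n) (Fin n) ℂ) :=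
  rfl

end VectorField

/-! ## Flow lines, the route predicate, and the definition of the flow -/

section Definition

/-- `V : ℝ → GaugeConfig d L SU(n)` is a (global, two-sided) Wilson flow line through `U`: `V 0 = U` and, for every
link `e`, every real time `t` and all matrix entries `(i, j)`, `s ↦ (V s e)ᵢⱼ` has derivative `(−P(Ω_e(V t)) V t e)ᵢⱼ`
at `t` [cite: Luscher2010, eq. (1.4)]. -/
def IsWilsonFlowLine (U : GaugeConfig d L SU[n]) (V : ℝ → GaugeConfig d L SU[n]) : Prop :=
  V 0 = U ∧ ∀ (t : ℝ) (e : Edge d L) (i j : Fin n),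
    HasDerivAt (fun s : ℝ => ((V s e : SU[n]) : Matrix (Fin n) (Fin n) ℂ) i j) (wilsonFlowVF (V t) e i j) t

/-- The route's inline predicate on a family `B : ℝ → GaugeConfig → GaugeConfig` ("`B s U` is any solution of
Lüscher's lattice flow with `B 0 U = U`"): initial condition, and the flow ODE entrywise at every `τ ≥ 0`
(items `FlowedEnergyUVBound`, `LatticeFlowEpsilonRegularity` of route `GradientFlowSpecies`, with `1/6 = 1/(2·3)`)
[cite: Luscher2010, eq. (1.4)]. -/
def IsWilsonFlowSolution
    (B : ℝ → GaugeConfig d L SU[n] → GaugeConfig d L SU[n]) : Prop :=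
  (∀ U, B 0 U = U) ∧ ∀ (U : GaugeConfig d L SU[n]) (y : Site d L) (μ : Fin d) (τ : ℝ), 0 ≤ τ →
    ∀ i j : Fin n, HasDerivAt (fun s : ℝ => ((B s U (y, μ) : SU[n]) : Matrix (Fin n) (Fin n) ℂ) i j)
      ((-suProj (plaquetteLoopSum (B τ U) y μ) * ((B τ U (y, μ) : SU[n]) : Matrix (Fin n) (Fin n) ℂ)) i j) τ

open Classical in
/-- **The Wilson flow** `V_t = wilsonFlow t U` of an `SU(n)` lattice gauge field on the torus `(ℤ/Lℤ)^d`: the value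
at time `t ∈ ℝ` of the unique global solution of Lüscher's flow equation `V̇_t(x,μ) = −g₀²{∂_{x,μ}S_w(V_t)}V_t(x,μ)
= −P(Ω_{x,μ}(V_t)) V_t(x,μ)`, `V_0 = U` [cite: Luscher2010, eqs. (1.3)–(1.4)]. Existence for all `t ∈ ℝ` and
uniqueness are `isWilsonFlowLine_wilsonFlow` / `IsWilsonFlowLine.eq_wilsonFlow` below (so the `choose` is
determined and the `else` branch is never taken when `L ≥ 1`; for `L = 0`, i.e. on `ℤ^d`, the value is
not characterised here). -/
def wilsonFlow (t : ℝ) (U : GaugeConfig d L SU[n]) : GaugeConfig d L SU[n] :=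
  if h : ∃ V, IsWilsonFlowLine U V then h.choose t else U

/-- `wilsonFlow 0 U = U` (unconditionally, by construction). [cite: Luscher2010, eq. (1.4)] -/
@[simp] theorem wilsonFlow_zero (U : GaugeConfig d L SU[n]) : wilsonFlow 0 U = U := by
  unfold wilsonFlow
  split_ifs with h
  · exact h.choose_spec.1
  · rfl

end Definition

/-! ## Proof machinery: the flow in the ambient matrix space

Everything in the namespace `WilsonFlow` is infrastructure for the existence/uniqueness proofs: the state space is
the space `GaugeConfig d L (Matrix (Fin n) (Fin n) ℂ)` of matrix-valued configurations, a finite product of copies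
of `M_n(ℂ)` carrying the Frobenius norm (scoped instances `Matrix.Norms.Frobenius`). -/

namespace WilsonFlow

open scoped Matrix.Norms.Frobenius

/-- A group-valued configuration read as a matrix-valued one (the embedding `SU(n)^E ↪ M_n(ℂ)^E`). [folklore] -/
def coeConfig (V : GaugeConfig d L SU[n]) : GaugeConfig d L (Matrix (Fin n) (Fin n) ℂ) :=
  fun e => ((V e : SU[n]) : Matrix (Fin n) (Fin n) ℂ)

/-- `coeConfig` evaluated. [folklore] -/
@[simp] theorem coeConfig_apply (V : GaugeConfig d L SU[n]) (e : Edge d L) :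
    coeConfig V e = ((V e : SU[n]) : Matrix (Fin n) (Fin n) ℂ) := rfl

/-- `coeConfig` is injective. [folklore] -/
theorem coeConfig_injective : Function.Injective (coeConfig (d := d) (L := L) (n := n)) := by
  intro V W h
  funext e
  exact Subtype.ext (congr_fun h e)

/-- In `SU(n)` the inverse is the conjugate transpose (as matrices). [folklore] -/
@[simp] theorem coe_inv_SU (A : SU[n]) : ((A⁻¹ : SU[n]) : Matrix (Fin n) (Fin n) ℂ) = (A : Matrix (Fin n) (Fin n) ℂ)ᴴ :=
  rfl

/-- Multiplication in `SU(n)` is matrix multiplication. [folklore] -/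
@[simp] theorem coe_mul_SU (A B : SU[n]) :
    ((A * B : SU[n]) : Matrix (Fin n) (Fin n) ℂ) = (A : Matrix (Fin n) (Fin n) ℂ) * (B : Matrix (Fin n) (Fin n) ℂ) :=
  rfl

/-- Elements of `SU(n)` are unitary: `Aᴴ A = 1`. [folklore] -/
theorem conjTranspose_mul_self_SU (A : SU[n]) :
    (A : Matrix (Fin n) (Fin n) ℂ)ᴴ * (A : Matrix (Fin n) (Fin n) ℂ) = 1 :=
  A.2.1.1

/-- Elements of `SU(n)` are unitary: `A Aᴴ = 1`. [folklore] -/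
theorem mul_conjTranspose_self_SU (A : SU[n]) :
    (A : Matrix (Fin n) (Fin n) ℂ) * (A : Matrix (Fin n) (Fin n) ℂ)ᴴ = 1 :=
  A.2.1.2

/-- The ambient ("matrix-valued") version of `plaquetteLoopSum`: the same sum of loops with every group inverse
replaced by a conjugate transpose, a polynomial in the entries of `W` and their conjugates. [folklore] -/
def loopSumAmb (W : GaugeConfig d L (Matrix (Fin n) (Fin n) ℂ)) (x : Site d L) (μ : Fin d) :
    Matrix (Fin n) (Fin n) ℂ :=
  ∑ ν : Fin d, if ν = μ then (0 : Matrix (Fin n) (Fin n) ℂ) else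
    (W (x, μ) * W (x.shift μ, ν) * (W (x.shift ν, μ))ᴴ * (W (x, ν))ᴴ +
      (W (x - Pi.single ν 1, ν))ᴴ *
          (W (x - Pi.single ν 1, ν) * W ((x - Pi.single ν 1).shift ν, μ) *
            (W ((x - Pi.single ν 1).shift μ, ν))ᴴ * (W (x - Pi.single ν 1, μ))ᴴ) *
        W (x - Pi.single ν 1, ν))

/-- On group-valued configurations the ambient loop sum is `plaquetteLoopSum`. [folklore] -/
theorem loopSumAmb_coeConfig (V : GaugeConfig d L SU[n]) (x : Site d L) (μ : Fin d) :
    loopSumAmb (coeConfig V) x μ = plaquetteLoopSum V x μ := by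
  unfold loopSumAmb plaquetteLoopSum plaquetteHolonomy
  simp only [coeConfig_apply, coe_mul_SU, coe_inv_SU]

/-- The ambient Wilson-flow vector field `Z(W)(e) = −P(Ω_e(W)) · W(e)` on matrix-valued configurations. [folklore] -/
def vfAmb (W : GaugeConfig d L (Matrix (Fin n) (Fin n) ℂ)) : GaugeConfig d L (Matrix (Fin n) (Fin n) ℂ) :=
  fun e => -suProj (loopSumAmb W e.1 e.2) * W e

/-- `vfAmb` evaluated. [folklore] -/
theorem vfAmb_apply (W : GaugeConfig d L (Matrix (Fin n) (Fin n) ℂ)) (e : Edge d L) :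
    vfAmb W e = -suProj (loopSumAmb W e.1 e.2) * W e := rfl

/-- On group-valued configurations the ambient vector field is `wilsonFlowVF`. [folklore] -/
theorem vfAmb_coeConfig (V : GaugeConfig d L SU[n]) (e : Edge d L) :
    vfAmb (coeConfig V) e = wilsonFlowVF V e := by
  rw [vfAmb_apply, loopSumAmb_coeConfig, wilsonFlowVF, coeConfig_apply]

/-- `coeConfig` is continuous. [folklore] -/
theorem continuous_coeConfig : Continuous (coeConfig (d := d) (L := L) (n := n)) :=
  continuous_pi fun e => continuous_subtype_val.comp (continuous_apply e)

/-- The image of `SU(n)^E` in the ambient space is compact. [folklore] -/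
theorem isCompact_range_coeConfig : IsCompact (Set.range (coeConfig (d := d) (L := L) (n := n))) :=
  isCompact_range continuous_coeConfig

section Smooth

variable [NeZero L]

/-- Conjugate transposition is `C^∞` (it is a continuous real-linear map). [folklore] -/
theorem contDiff_conjTranspose {m : WithTop ℕ∞} :
    ContDiff ℝ m (fun W : Matrix (Fin n) (Fin n) ℂ => Wᴴ) :=
  (starL' ℝ : Matrix (Fin n) (Fin n) ℂ ≃L[ℝ] Matrix (Fin n) (Fin n) ℂ).contDiff

/-- The trace is `C^∞` (a continuous linear map). [folklore] -/
theorem contDiff_trace {m : WithTop ℕ∞} :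
    ContDiff ℝ m (fun W : Matrix (Fin n) (Fin n) ℂ => W.trace) :=
  (LinearMap.toContinuousLinearMap (Matrix.traceLinearMap (Fin n) ℝ ℂ)).contDiff

/-- The projection `P` is `C^∞`. [folklore] -/
theorem contDiff_suProj {m : WithTop ℕ∞} : ContDiff ℝ m (suProj (n := n)) := by
  unfold suProj
  have h1 : ContDiff ℝ m (fun W : Matrix (Fin n) (Fin n) ℂ => W - Wᴴ) := contDiff_id.sub contDiff_conjTranspose
  refine (h1.const_smul (1 / 2 : ℂ)).sub ?_
  exact ((contDiff_trace.comp h1).const_smul (1 / (2 * n) : ℂ)).smul contDiff_const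

/-- Each link variable is a `C^∞` function of the configuration. [folklore] -/
theorem contDiff_eval {m : WithTop ℕ∞} (e : Edge d L) :
    ContDiff ℝ m (fun W : GaugeConfig d L (Matrix (Fin n) (Fin n) ℂ) => W e) :=
  contDiff_apply ℝ (Matrix (Fin n) (Fin n) ℂ) e

/-- Each conjugate-transposed link variable is a `C^∞` function of the configuration. [folklore] -/
theorem contDiff_eval_conjTranspose {m : WithTop ℕ∞} (e : Edge d L) :
    ContDiff ℝ m (fun W : GaugeConfig d L (Matrix (Fin n) (Fin n) ℂ) => (W e)ᴴ) :=
  contDiff_conjTranspose.comp (contDiff_eval e)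

/-- The ambient loop sum is `C^∞`. [folklore] -/
theorem contDiff_loopSumAmb {m : WithTop ℕ∞} (x : Site d L) (μ : Fin d) :
    ContDiff ℝ m (fun W : GaugeConfig d L (Matrix (Fin n) (Fin n) ℂ) => loopSumAmb W x μ) := by
  unfold loopSumAmb
  refine ContDiff.sum fun ν _ => ?_
  by_cases h : ν = μ
  · simp only [h, if_true]
    exact contDiff_const
  · simp only [h, if_false]
    refine ContDiff.add ?_ ?_
    · exact (((contDiff_eval _).mul (contDiff_eval _)).mul (contDiff_eval_conjTranspose _)).mul
        (contDiff_eval_conjTranspose _)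
    · exact ((contDiff_eval_conjTranspose _).mul
        ((((contDiff_eval _).mul (contDiff_eval _)).mul (contDiff_eval_conjTranspose _)).mul
          (contDiff_eval_conjTranspose _))).mul (contDiff_eval _)

/-- The ambient vector field is `C^∞`. [folklore] -/
theorem contDiff_vfAmb {m : WithTop ℕ∞} : ContDiff ℝ m (vfAmb (d := d) (L := L) (n := n)) := by
  refine contDiff_pi.2 fun e => ?_
  exact (contDiff_suProj.comp (contDiff_loopSumAmb e.1 e.2)).neg.mul (contDiff_eval e)

/-- A radius `ρ₀ ≥ 0` such that every `SU(n)` configuration lies in the closed ball of radius `ρ₀`. [folklore] -/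
theorem exists_radius :
    ∃ ρ : ℝ≥0, ∀ V : GaugeConfig d L SU[n], coeConfig V ∈ closedBall (0 : GaugeConfig d L (Matrix (Fin n) (Fin n) ℂ)) ρ := by
  obtain ⟨r, hr⟩ := (isCompact_range_coeConfig (d := d) (L := L) (n := n)).isBounded.subset_closedBall 0
  refine ⟨⟨max r 0, le_max_right _ _⟩, fun V => ?_⟩
  exact closedBall_subset_closedBall (le_max_left _ _) (hr ⟨V, rfl⟩)

/-- The radius `ρ₀` of `exists_radius`. [folklore] -/
def ρ₀ (d L n : ℕ) [NeZero L] : ℝ≥0 := (exists_radius (d := d) (L := L) (n := n)).choose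

/-- Every `SU(n)` configuration lies in `closedBall 0 ρ₀`. [folklore] -/
theorem coeConfig_mem_closedBall (V : GaugeConfig d L SU[n]) :
    coeConfig V ∈ closedBall (0 : GaugeConfig d L (Matrix (Fin n) (Fin n) ℂ)) (ρ₀ d L n) :=
  (exists_radius (d := d) (L := L) (n := n)).choose_spec V

/-- Every `SU(n)` configuration has norm `≤ ρ₀`. [folklore] -/
theorem norm_coeConfig_le (V : GaugeConfig d L SU[n]) : ‖coeConfig V‖ ≤ ρ₀ d L n := by
  simpa only [mem_closedBall, dist_zero_right] using coeConfig_mem_closedBall V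

end Smooth

/-! ### Matrix calculus: entries, and Liouville's formula for the determinant -/

section MatrixCalculus

/-- A matrix entry as a continuous real-linear functional (Frobenius norm). [folklore] -/
def entryCLM (i j : Fin n) : Matrix (Fin n) (Fin n) ℂ →L[ℝ] ℂ :=
  LinearMap.toContinuousLinearMap (Matrix.entryLinearMap ℝ ℂ i j)

/-- `entryCLM i j M = M i j`. [folklore] -/
@[simp] theorem entryCLM_apply (i j : Fin n) (M : Matrix (Fin n) (Fin n) ℂ) : entryCLM i j M = M i j := rfl

/-- Entries of a differentiable matrix-valued curve are differentiable (within a set). [folklore] -/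
theorem hasDerivWithinAt_entry {f : ℝ → Matrix (Fin n) (Fin n) ℂ} {f' : Matrix (Fin n) (Fin n) ℂ} {s : Set ℝ}
    {t : ℝ} (h : HasDerivWithinAt f f' s t) (i j : Fin n) :
    HasDerivWithinAt (fun τ => f τ i j) (f' i j) s t :=
  (entryCLM i j).hasFDerivAt.comp_hasDerivWithinAt t h

/-- Entries of a differentiable matrix-valued curve are differentiable. [folklore] -/
theorem hasDerivAt_entry {f : ℝ → Matrix (Fin n) (Fin n) ℂ} {f' : Matrix (Fin n) (Fin n) ℂ} {t : ℝ}
    (h : HasDerivAt f f' t) (i j : Fin n) : HasDerivAt (fun τ => f τ i j) (f' i j) t :=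
  (entryCLM i j).hasFDerivAt.comp_hasDerivAt t h

/-- A matrix-valued curve all of whose entries are differentiable is differentiable (Frobenius norm, or any
norm: the statement is about a finite sum of scalar curves times constant matrices). [folklore] -/
theorem hasDerivAt_of_entries {f : ℝ → Matrix (Fin n) (Fin n) ℂ} {f' : Matrix (Fin n) (Fin n) ℂ} {t : ℝ}
    (h : ∀ i j, HasDerivAt (fun τ => f τ i j) (f' i j) t) : HasDerivAt f f' t := by
  have key : HasDerivAt (fun τ => ∑ i, ∑ j, Matrix.single i j (f τ i j))
      (∑ i, ∑ j, Matrix.single i j (f' i j)) t := by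
    refine HasDerivAt.fun_sum fun i _ => HasDerivAt.fun_sum fun j _ => ?_
    have hs : ∀ c : ℂ, Matrix.single i j c = c • Matrix.single i j (1 : ℂ) := fun c => by
      rw [Matrix.smul_single, smul_eq_mul, mul_one]
    simp only [hs (f _ i j), hs (f' i j)]
    exact (h i j).smul_const _
  have hf : (fun τ => ∑ i, ∑ j, Matrix.single i j (f τ i j)) = f := funext fun τ => (matrix_eq_sum_single (f τ)).symm
  rwa [hf, ← matrix_eq_sum_single f'] at key

/-- **Jacobi's formula** (column form): along a curve of matrices with entrywise derivatives `A'`,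
`d/dt det A = ∑ₖ det (A with column k replaced by column k of A')`. [folklore] -/
theorem hasDerivWithinAt_det {A : ℝ → Matrix (Fin n) (Fin n) ℂ} {A' : Matrix (Fin n) (Fin n) ℂ} {s : Set ℝ} {t : ℝ}
    (hA : ∀ i j, HasDerivWithinAt (fun τ => A τ i j) (A' i j) s t) :
    HasDerivWithinAt (fun τ => (A τ).det) (∑ k, ((A t).updateCol k fun i => A' i k).det) s t := by
  have hdet : (fun τ => (A τ).det) =
      fun τ => ∑ σ : Equiv.Perm (Fin n), (Equiv.Perm.sign σ : ℂ) * ∏ i, A τ (σ i) i := by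
    funext τ
    rw [Matrix.det_apply']
  rw [hdet]
  have h1 : HasDerivWithinAt (fun τ => ∑ σ : Equiv.Perm (Fin n), (Equiv.Perm.sign σ : ℂ) * ∏ i, A τ (σ i) i)
      (∑ σ : Equiv.Perm (Fin n), (Equiv.Perm.sign σ : ℂ) *
        ∑ i, (∏ j ∈ Finset.univ.erase i, A t (σ j) j) • A' (σ i) i) s t := by
    refine HasDerivWithinAt.fun_sum fun σ _ => ?_
    exact (HasDerivWithinAt.fun_finsetProd (u := Finset.univ) fun i _ => hA (σ i) i).const_mul _
  convert h1 using 1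
  simp only [Matrix.det_apply', Matrix.updateCol_apply, smul_eq_mul, Finset.mul_sum]
  rw [Finset.sum_comm]
  refine Finset.sum_congr rfl fun σ _ => Finset.sum_congr rfl fun k _ => ?_
  congr 1
  rw [← Finset.mul_prod_erase Finset.univ _ (Finset.mem_univ k), if_pos rfl, mul_comm]
  congr 1
  exact Finset.prod_congr rfl fun i hi => by rw [if_neg (Finset.ne_of_mem_erase hi)]

/-- The Cramer/trace identity behind Liouville's formula:
`∑ₖ det (M with column k replaced by column k of Y M) = tr Y · det M`. [folklore] -/
theorem sum_det_updateCol_mul (M Y : Matrix (Fin n) (Fin n) ℂ) :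
    ∑ k, (M.updateCol k fun i => (Y * M) i k).det = Y.trace * M.det := by
  have hcol : ∀ k, (fun i => (Y * M) i k) = ∑ m, M m k • fun i => Y i m := by
    intro k
    funext i
    simp only [Matrix.mul_apply, Finset.sum_apply, Pi.smul_apply, smul_eq_mul]
    exact Finset.sum_congr rfl fun m _ => mul_comm _ _
  calc ∑ k, (M.updateCol k fun i => (Y * M) i k).det
      = ∑ k, ∑ m, M m k * M.cramer (fun i => Y i m) k := by
        refine Finset.sum_congr rfl fun k _ => ?_
        rw [← Matrix.cramer_apply, hcol, map_sum, Finset.sum_apply]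
        refine Finset.sum_congr rfl fun m _ => ?_
        rw [map_smul, Pi.smul_apply, smul_eq_mul]
    _ = ∑ m, (M *ᵥ M.cramer fun i => Y i m) m := by
        rw [Finset.sum_comm]
        rfl
    _ = ∑ m, M.det * Y m m := by
        simp [Matrix.mulVec_cramer]
    _ = Y.trace * M.det := by
        rw [Matrix.trace, ← Finset.mul_sum, mul_comm]
        rfl

/-- **Liouville's formula**: if `Ȧ = Y A` at `t` then `d/dt det A = tr Y · det A` at `t`. [folklore] -/
theorem hasDerivWithinAt_det_of_mul {A : ℝ → Matrix (Fin n) (Fin n) ℂ} {Y : Matrix (Fin n) (Fin n) ℂ} {s : Set ℝ}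
    {t : ℝ} (hA : HasDerivWithinAt A (Y * A t) s t) :
    HasDerivWithinAt (fun τ => (A τ).det) (Y.trace * (A t).det) s t := by
  have h := hasDerivWithinAt_det fun i j => hasDerivWithinAt_entry hA i j
  rwa [sum_det_updateCol_mul] at h

/-- **Invariance of `SU(n)`**: a matrix curve on an interval solving `Ȧ = −X(τ) A` with every `X(τ)` anti-Hermitian
and traceless, which lies in `SU(n)` at one time, lies in `SU(n)` at all times of the interval
(`d/dt (AᴴA) = −Aᴴ(Xᴴ + X)A = 0` and Liouville `d/dt det A = −tr X · det A = 0`). [folklore] -/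
theorem mem_SU_of_ode {A X : ℝ → Matrix (Fin n) (Fin n) ℂ} {a b t₀ : ℝ} (ht₀ : t₀ ∈ Icc a b)
    (hA : ∀ τ ∈ Icc a b, HasDerivWithinAt A (-X τ * A τ) (Icc a b) τ)
    (hX : ∀ τ ∈ Icc a b, (X τ)ᴴ = -X τ) (hX' : ∀ τ ∈ Icc a b, (X τ).trace = 0)
    (h0 : A t₀ ∈ SU[n]) : ∀ τ ∈ Icc a b, A τ ∈ SU[n] := by
  rw [Matrix.mem_specialUnitaryGroup_iff] at h0
  -- unitarity is conserved
  have hU : ∀ τ ∈ Icc a b, star (A τ) * A τ = 1 := by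
    have hd := fun τ (hτ : τ ∈ Icc a b) =>
      (((hA τ hτ).star).fun_mul (hA τ hτ)).congr_deriv
        (show star (-X τ * A τ) * A τ + star (A τ) * (-X τ * A τ) = 0 by
          simp only [Matrix.star_eq_conjTranspose, Matrix.conjTranspose_mul, Matrix.conjTranspose_neg, hX τ hτ,
            neg_neg, neg_mul, mul_neg, Matrix.mul_assoc, add_neg_cancel])
    intro τ hτ
    have key := (convex_Icc a b).norm_image_sub_le_of_norm_hasDerivWithin_le (f' := fun _ => 0) hd
      (fun _ _ => by rw [norm_zero]) ht₀ hτ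
    rw [zero_mul, norm_le_zero_iff, sub_eq_zero] at key
    rw [key]
    exact Matrix.mem_unitaryGroup_iff'.mp h0.1
  -- the determinant is conserved
  have hD : ∀ τ ∈ Icc a b, (A τ).det = 1 := by
    have hd := fun τ (hτ : τ ∈ Icc a b) =>
      (hasDerivWithinAt_det_of_mul (hA τ hτ)).congr_deriv
        (show (-X τ).trace * (A τ).det = 0 by rw [Matrix.trace_neg, hX' τ hτ, neg_zero, zero_mul])
    intro τ hτ
    have key := (convex_Icc a b).norm_image_sub_le_of_norm_hasDerivWithin_le (f' := fun _ => 0) hd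
      (fun _ _ => by rw [norm_zero]) ht₀ hτ
    rw [zero_mul, norm_le_zero_iff, sub_eq_zero] at key
    rw [key]
    exact h0.2
  intro τ hτ
  exact Matrix.mem_specialUnitaryGroup_iff.mpr ⟨Matrix.mem_unitaryGroup_iff'.mpr (hU τ hτ), hD τ hτ⟩

end MatrixCalculus

/-! ### The cut-off vector field, Picard–Lindelöf on `[-T, T]`, and the global flow line -/

section Existence

variable [NeZero L]

/-- The polynomial "squared Euclidean norm" `q(W) = ∑_e ∑_{i,j} ‖W(e)ᵢⱼ‖²` of a matrix-valued configuration
(used to build a smooth cut-off; the sup/Frobenius norm itself is not smooth). [folklore] -/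
def sqNorm (W : GaugeConfig d L (Matrix (Fin n) (Fin n) ℂ)) : ℝ :=
  ∑ e, ∑ i, ∑ j, ‖W e i j‖ ^ 2

/-- `q` is `C^∞`. [folklore] -/
theorem contDiff_sqNorm {m : WithTop ℕ∞} : ContDiff ℝ m (sqNorm (d := d) (L := L) (n := n)) := by
  unfold sqNorm
  refine ContDiff.sum fun e _ => ContDiff.sum fun i _ => ContDiff.sum fun j _ => ?_
  exact (contDiff_norm_sq ℝ).comp ((entryCLM i j).contDiff.comp (contDiff_eval e))

/-- `q ≥ 0`. [folklore] -/
theorem sqNorm_nonneg (W : GaugeConfig d L (Matrix (Fin n) (Fin n) ℂ)) : 0 ≤ sqNorm W := by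
  unfold sqNorm
  positivity

/-- The squared Frobenius norm is the sum of the squared entries. [folklore] -/
theorem frobenius_norm_sq (A : Matrix (Fin n) (Fin n) ℂ) : ‖A‖ ^ 2 = ∑ i, ∑ j, ‖A i j‖ ^ 2 := by
  rw [Matrix.frobenius_norm_def, ← Real.sqrt_eq_rpow, Real.sq_sqrt (by positivity)]
  simp only [Real.rpow_two]

/-- `‖W‖ ≤ √q(W)` (each link's squared Frobenius norm is one term of `q`). [folklore] -/
theorem norm_le_sqrt_sqNorm (W : GaugeConfig d L (Matrix (Fin n) (Fin n) ℂ)) : ‖W‖ ≤ √(sqNorm W) := by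
  refine (pi_norm_le_iff_of_nonneg (Real.sqrt_nonneg _)).2 fun e => ?_
  refine Real.le_sqrt_of_sq_le ?_
  rw [frobenius_norm_sq]
  exact Finset.single_le_sum (f := fun e => ∑ i, ∑ j, ‖W e i j‖ ^ 2) (fun e _ => by positivity) (Finset.mem_univ e)

/-- The bound `q ≤ |E| · n²` on `SU(n)` configurations (every entry of a unitary matrix has norm `≤ 1`). [folklore] -/
def qmax (d L n : ℕ) [NeZero L] : ℝ := Fintype.card (Edge d L) * (n * n)

/-- `q(U) ≤ qmax` for `SU(n)` configurations. [folklore] -/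
theorem sqNorm_coeConfig_le (V : GaugeConfig d L SU[n]) : sqNorm (coeConfig V) ≤ qmax d L n := by
  unfold sqNorm qmax
  have h1 : ∀ (e : Edge d L) (i j : Fin n), ‖coeConfig V e i j‖ ^ 2 ≤ 1 := fun e i j => by
    have hle : ‖((V e : SU[n]) : Matrix (Fin n) (Fin n) ℂ) i j‖ ≤ 1 := entry_norm_bound_of_unitary (V e).2.1 i j
    rw [coeConfig_apply]
    exact pow_le_one₀ (norm_nonneg _) hle
  calc ∑ e, ∑ i, ∑ j, ‖coeConfig V e i j‖ ^ 2 ≤ ∑ _e : Edge d L, ∑ _i : Fin n, ∑ _j : Fin n, (1 : ℝ) :=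
        Finset.sum_le_sum fun e _ => Finset.sum_le_sum fun i _ => Finset.sum_le_sum fun j _ => h1 e i j
    _ = Fintype.card (Edge d L) * (n * n) := by simp [mul_comm]

/-- The smooth cut-off `χ(W) = smoothTransition (qmax + 2 − q(W))`: equal to `1` where `q ≤ qmax + 1` (in particular on
`SU(n)^E`) and to `0` where `q ≥ qmax + 2`. [folklore] -/
def cutoff (W : GaugeConfig d L (Matrix (Fin n) (Fin n) ℂ)) : ℝ :=
  Real.smoothTransition (qmax d L n + 2 - sqNorm W)

/-- The cut-off is `C^∞`. [folklore] -/
theorem contDiff_cutoff {m : ℕ∞} : ContDiff ℝ m (cutoff (d := d) (L := L) (n := n)) := by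
  unfold cutoff
  exact Real.smoothTransition.contDiff.comp (contDiff_const.sub contDiff_sqNorm)

/-- The cut-off is `1` where `q ≤ qmax + 1`. [folklore] -/
theorem cutoff_eq_one {W : GaugeConfig d L (Matrix (Fin n) (Fin n) ℂ)} (hW : sqNorm W ≤ qmax d L n + 1) :
    cutoff W = 1 :=
  Real.smoothTransition.one_of_one_le (by linarith)

/-- The cut-off vanishes where `q ≥ qmax + 2`. [folklore] -/
theorem cutoff_eq_zero {W : GaugeConfig d L (Matrix (Fin n) (Fin n) ℂ)} (hW : qmax d L n + 2 ≤ sqNorm W) :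
    cutoff W = 0 :=
  Real.smoothTransition.zero_of_nonpos (by linarith)

/-- The cut-off has compact support (it vanishes outside `closedBall 0 √(qmax + 2)`). [folklore] -/
theorem hasCompactSupport_cutoff : HasCompactSupport (cutoff (d := d) (L := L) (n := n)) := by
  refine HasCompactSupport.intro (isCompact_closedBall (0 : GaugeConfig d L (Matrix (Fin n) (Fin n) ℂ))
    (√(qmax d L n + 2))) fun W hW => cutoff_eq_zero ?_
  rw [mem_closedBall, dist_zero_right, not_le] at hW
  have h := hW.trans_le (norm_le_sqrt_sqNorm W)
  have hq : 0 ≤ qmax d L n + 2 := by unfold qmax; positivity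
  exact ((Real.sqrt_lt_sqrt_iff hq).1 h).le

/-- The cut-off vector field `χ(W) • Z(W)`: globally Lipschitz and bounded, equal to `Z` near `SU(n)^E`, and
still of the form "(anti-Hermitian traceless) × link" linkwise. [folklore] -/
def vfCut (W : GaugeConfig d L (Matrix (Fin n) (Fin n) ℂ)) : GaugeConfig d L (Matrix (Fin n) (Fin n) ℂ) :=
  cutoff W • vfAmb W

/-- `vfCut` linkwise: `−(χ(W) • P(Ω_e(W))) · W(e)`. [folklore] -/
theorem vfCut_apply (W : GaugeConfig d L (Matrix (Fin n) (Fin n) ℂ)) (e : Edge d L) :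
    vfCut W e = -((cutoff W) • suProj (loopSumAmb W e.1 e.2)) * W e := by
  rw [vfCut, Pi.smul_apply, vfAmb_apply, neg_mul, neg_mul, smul_mul_assoc, smul_neg]

/-- `vfCut` is `C¹`. [folklore] -/
theorem contDiff_vfCut : ContDiff ℝ 1 (vfCut (d := d) (L := L) (n := n)) :=
  (contDiff_cutoff (m := 1)).smul contDiff_vfAmb

/-- `vfCut` has compact support. [folklore] -/
theorem hasCompactSupport_vfCut : HasCompactSupport (vfCut (d := d) (L := L) (n := n)) :=
  hasCompactSupport_cutoff.smul_right

/-- `vfCut = vfAmb` where `q ≤ qmax + 1`, in particular on `SU(n)^E`. [folklore] -/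
theorem vfCut_eq_of_sqNorm_le {W : GaugeConfig d L (Matrix (Fin n) (Fin n) ℂ)} (hW : sqNorm W ≤ qmax d L n + 1) :
    vfCut W = vfAmb W := by
  rw [vfCut, cutoff_eq_one hW, one_smul]

/-- `vfCut` is globally Lipschitz. [folklore] -/
theorem exists_lipschitzWith_vfCut : ∃ K, LipschitzWith K (vfCut (d := d) (L := L) (n := n)) :=
  ContDiff.lipschitzWith_of_hasCompactSupport hasCompactSupport_vfCut contDiff_vfCut one_ne_zero

/-- A global Lipschitz constant of `vfCut`. [folklore] -/
def Kcut (d L n : ℕ) [NeZero L] : ℝ≥0 := (exists_lipschitzWith_vfCut (d := d) (L := L) (n := n)).choose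

/-- `vfCut` is `Kcut`-Lipschitz. [folklore] -/
theorem lipschitzWith_vfCut : LipschitzWith (Kcut d L n) (vfCut (d := d) (L := L) (n := n)) :=
  (exists_lipschitzWith_vfCut (d := d) (L := L) (n := n)).choose_spec

/-- `vfCut` is bounded. [folklore] -/
theorem exists_bound_vfCut : ∃ C : ℝ, ∀ W, ‖vfCut (d := d) (L := L) (n := n) W‖ ≤ C :=
  contDiff_vfCut.continuous.bounded_above_of_compact_support hasCompactSupport_vfCut

/-- A global bound of `vfCut`. [folklore] -/
def Ccut (d L n : ℕ) [NeZero L] : ℝ≥0 :=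
  ⟨max (exists_bound_vfCut (d := d) (L := L) (n := n)).choose 0, le_max_right _ _⟩

/-- `‖vfCut W‖ ≤ Ccut`. [folklore] -/
theorem norm_vfCut_le (W : GaugeConfig d L (Matrix (Fin n) (Fin n) ℂ)) : ‖vfCut W‖ ≤ Ccut d L n :=
  ((exists_bound_vfCut (d := d) (L := L) (n := n)).choose_spec W).trans (le_max_left _ _)

/-- `0 ∈ [-T, T]`. [folklore] -/
theorem zero_mem_Icc (T : ℝ≥0) : (0 : ℝ) ∈ Icc (-(T : ℝ)) T :=
  ⟨neg_nonpos.mpr T.coe_nonneg, T.coe_nonneg⟩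

/-- The Picard–Lindelöf hypotheses for `vfCut` on the time interval `[-T, T]`, for all initial points in
`closedBall 0 ρ₀` (in particular all `SU(n)` configurations). [folklore] -/
theorem isPicardLindelof_vfCut (T : ℝ≥0) :
    IsPicardLindelof (fun _ : ℝ => vfCut (d := d) (L := L) (n := n)) (tmin := -(T : ℝ)) (tmax := T)
      ⟨0, zero_mem_Icc T⟩ 0 (ρ₀ d L n + Ccut d L n * T) (ρ₀ d L n) (Ccut d L n) (Kcut d L n) := by
  refine IsPicardLindelof.of_time_independent (fun W _ => norm_vfCut_le W) lipschitzWith_vfCut.lipschitzOnWith ?_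
  have hmax : max ((T : ℝ) - 0) (0 - -(T : ℝ)) = T := by simp
  rw [hmax]
  push_cast
  linarith

/-- Local flows of `vfCut` on `[-T, T]`, Lipschitz in the initial point (Mathlib's Picard–Lindelöf). [folklore] -/
theorem exists_localFlow (T : ℝ≥0) :
    ∃ α : GaugeConfig d L (Matrix (Fin n) (Fin n) ℂ) → ℝ → GaugeConfig d L (Matrix (Fin n) (Fin n) ℂ),
      (∀ x ∈ closedBall (0 : GaugeConfig d L (Matrix (Fin n) (Fin n) ℂ)) (ρ₀ d L n), α x 0 = x ∧
        ∀ t ∈ Icc (-(T : ℝ)) T, HasDerivWithinAt (α x) (vfCut (α x t)) (Icc (-(T : ℝ)) T) t) ∧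
      ∃ L' : ℝ≥0, ∀ t ∈ Icc (-(T : ℝ)) T,
        LipschitzOnWith L' (α · t) (closedBall (0 : GaugeConfig d L (Matrix (Fin n) (Fin n) ℂ)) (ρ₀ d L n)) :=
  (isPicardLindelof_vfCut T).exists_forall_mem_closedBall_eq_hasDerivWithinAt_lipschitzOnWith

/-- A chosen local flow of `vfCut` on `[-T, T]`. [folklore] -/
def localFlow (T : ℝ≥0) :
    GaugeConfig d L (Matrix (Fin n) (Fin n) ℂ) → ℝ → GaugeConfig d L (Matrix (Fin n) (Fin n) ℂ) :=
  (exists_localFlow (d := d) (L := L) (n := n) T).choose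

/-- Initial condition of `localFlow`. [folklore] -/
theorem localFlow_zero (T : ℝ≥0) {x : GaugeConfig d L (Matrix (Fin n) (Fin n) ℂ)}
    (hx : x ∈ closedBall (0 : GaugeConfig d L (Matrix (Fin n) (Fin n) ℂ)) (ρ₀ d L n)) : localFlow T x 0 = x :=
  ((exists_localFlow (d := d) (L := L) (n := n) T).choose_spec.1 x hx).1

/-- `localFlow` solves the cut-off ODE on `[-T, T]`. [folklore] -/
theorem hasDerivWithinAt_localFlow (T : ℝ≥0) {x : GaugeConfig d L (Matrix (Fin n) (Fin n) ℂ)}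
    (hx : x ∈ closedBall (0 : GaugeConfig d L (Matrix (Fin n) (Fin n) ℂ)) (ρ₀ d L n)) {t : ℝ}
    (ht : t ∈ Icc (-(T : ℝ)) T) :
    HasDerivWithinAt (localFlow T x) (vfCut (localFlow T x t)) (Icc (-(T : ℝ)) T) t :=
  ((exists_localFlow (d := d) (L := L) (n := n) T).choose_spec.1 x hx).2 t ht

/-- `localFlow` is Lipschitz in the initial point, uniformly on `[-T, T]`. [folklore] -/
theorem exists_lipschitzOnWith_localFlow (T : ℝ≥0) :
    ∃ L' : ℝ≥0, ∀ t ∈ Icc (-(T : ℝ)) T, LipschitzOnWith L' (localFlow (d := d) (L := L) (n := n) T · t)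
      (closedBall (0 : GaugeConfig d L (Matrix (Fin n) (Fin n) ℂ)) (ρ₀ d L n)) :=
  (exists_localFlow (d := d) (L := L) (n := n) T).choose_spec.2

/-- **Invariance**: the local flow started at an `SU(n)` configuration stays in `SU(n)^E` on `[-T, T]`. [folklore] -/
theorem localFlow_mem_SU (T : ℝ≥0) (U : GaugeConfig d L SU[n]) {t : ℝ} (ht : t ∈ Icc (-(T : ℝ)) T)
    (e : Edge d L) : localFlow T (coeConfig U) t e ∈ SU[n] := by
  refine mem_SU_of_ode (A := fun τ => localFlow T (coeConfig U) τ e)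
    (X := fun τ => (cutoff (localFlow T (coeConfig U) τ)) • suProj (loopSumAmb (localFlow T (coeConfig U) τ) e.1 e.2))
    (zero_mem_Icc T) (fun τ hτ => ?_) (fun τ hτ => ?_) (fun τ hτ => ?_) ?_ t ht
  · have h := (hasDerivWithinAt_pi.1 (hasDerivWithinAt_localFlow T (coeConfig_mem_closedBall U) hτ)) e
    rw [vfCut_apply] at h
    exact h
  · rw [Matrix.conjTranspose_smul, conjTranspose_suProj, star_trivial, smul_neg]
  · rw [Matrix.trace_smul, trace_suProj, smul_zero]
  · rw [localFlow_zero T (coeConfig_mem_closedBall U), coeConfig_apply]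
    exact (U e).2

/-- The local flow at time `t ∈ [-T, T]` from an `SU(n)` configuration, as an `SU(n)` configuration. [folklore] -/
def localFlowSU (T : ℝ≥0) (U : GaugeConfig d L SU[n]) (t : ℝ) (ht : t ∈ Icc (-(T : ℝ)) T) :
    GaugeConfig d L SU[n] :=
  fun e => ⟨localFlow T (coeConfig U) t e, localFlow_mem_SU T U ht e⟩

/-- `localFlowSU` read in the ambient space is `localFlow`. [folklore] -/
theorem coeConfig_localFlowSU (T : ℝ≥0) (U : GaugeConfig d L SU[n]) (t : ℝ) (ht : t ∈ Icc (-(T : ℝ)) T) :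
    coeConfig (localFlowSU T U t ht) = localFlow T (coeConfig U) t := rfl

/-- Along the invariant set the cut-off is inactive: `localFlow` solves the TRUE flow equation. [folklore] -/
theorem hasDerivWithinAt_localFlow_vfAmb (T : ℝ≥0) (U : GaugeConfig d L SU[n]) {t : ℝ}
    (ht : t ∈ Icc (-(T : ℝ)) T) :
    HasDerivWithinAt (localFlow T (coeConfig U)) (vfAmb (localFlow T (coeConfig U) t)) (Icc (-(T : ℝ)) T) t := by
  have h := hasDerivWithinAt_localFlow T (coeConfig_mem_closedBall U) ht
  have hn : sqNorm (localFlow T (coeConfig U) t) ≤ qmax d L n + 1 := by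
    rw [← coeConfig_localFlowSU T U t ht]
    exact (sqNorm_coeConfig_le _).trans (le_add_of_nonneg_right zero_le_one)
  rwa [vfCut_eq_of_sqNorm_le hn] at h

/-- Two local flows from the same `SU(n)` configuration agree on the smaller time interval. [folklore] -/
theorem localFlow_eqOn (U : GaugeConfig d L SU[n]) {T₁ T₂ : ℝ≥0} (h0 : 0 < T₁) (h12 : T₁ ≤ T₂) :
    EqOn (localFlow T₁ (coeConfig U)) (localFlow T₂ (coeConfig U)) (Icc (-(T₁ : ℝ)) T₁) := by
  have h0' : (0 : ℝ) < T₁ := h0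
  have h12' : (T₁ : ℝ) ≤ T₂ := h12
  refine ODE_solution_unique_of_mem_Icc (v := fun _ => vfCut) (s := fun _ => univ) (K := Kcut d L n) (t₀ := 0)
    (fun _ _ => lipschitzWith_vfCut.lipschitzOnWith) ⟨by linarith, h0'⟩ ?_ ?_ (fun _ _ => trivial) ?_ ?_
    (fun _ _ => trivial) ?_
  · exact HasDerivWithinAt.continuousOn fun t ht => hasDerivWithinAt_localFlow T₁ (coeConfig_mem_closedBall U) ht
  · intro t ht
    exact (hasDerivWithinAt_localFlow T₁ (coeConfig_mem_closedBall U) (Ioo_subset_Icc_self ht)).hasDerivAt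
      (Icc_mem_nhds ht.1 ht.2)
  · exact (HasDerivWithinAt.continuousOn fun t ht =>
      hasDerivWithinAt_localFlow T₂ (coeConfig_mem_closedBall U) ht).mono (Icc_subset_Icc (by linarith) h12')
  · intro t ht
    have ht' : t ∈ Ioo (-(T₂ : ℝ)) T₂ := ⟨by linarith [ht.1], lt_of_lt_of_le ht.2 h12'⟩
    exact (hasDerivWithinAt_localFlow T₂ (coeConfig_mem_closedBall U) (Ioo_subset_Icc_self ht')).hasDerivAt
      (Icc_mem_nhds ht'.1 ht'.2)
  · rw [localFlow_zero T₁ (coeConfig_mem_closedBall U), localFlow_zero T₂ (coeConfig_mem_closedBall U)]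

/-- The time parameter `|t| + 1` used to define the global flow line at time `t`. [folklore] -/
def Tof (t : ℝ) : ℝ≥0 := ⟨|t| + 1, by positivity⟩

/-- `|t| < Tof t`. [folklore] -/
theorem abs_lt_Tof (t : ℝ) : |t| < (Tof t : ℝ) := by
  show |t| < |t| + 1
  linarith

/-- `t ∈ [-T, T]` when `|t| < T`. [folklore] -/
theorem mem_Icc_of_abs_lt {t : ℝ} {T : ℝ≥0} (h : |t| < (T : ℝ)) : t ∈ Icc (-(T : ℝ)) T :=
  ⟨(abs_lt.1 h).1.le, (abs_lt.1 h).2.le⟩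

/-- The global ambient flow line through `U`: at time `t`, the local flow on `[-(|t|+1), |t|+1]`. [folklore] -/
def flowAmb (U : GaugeConfig d L SU[n]) (t : ℝ) : GaugeConfig d L (Matrix (Fin n) (Fin n) ℂ) :=
  localFlow (Tof t) (coeConfig U) t

/-- The global flow line agrees with every local flow whose time interval contains `t` in its interior. [folklore] -/
theorem flowAmb_eq_localFlow (U : GaugeConfig d L SU[n]) {T : ℝ≥0} {t : ℝ} (ht : |t| < (T : ℝ)) :
    flowAmb U t = localFlow T (coeConfig U) t := by
  unfold flowAmb
  have hT : (0 : ℝ≥0) < T := by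
    have : (0 : ℝ) < T := (abs_nonneg t).trans_lt ht
    exact_mod_cast this
  have hTof : (0 : ℝ≥0) < Tof t := by
    have : (0 : ℝ) < Tof t := (abs_nonneg t).trans_lt (abs_lt_Tof t)
    exact_mod_cast this
  rcases le_total (Tof t) T with h | h
  · exact localFlow_eqOn U hTof h (mem_Icc_of_abs_lt (abs_lt_Tof t))
  · exact (localFlow_eqOn U hT h (mem_Icc_of_abs_lt ht)).symm

/-- The global ambient flow line solves the (true) flow equation at every time. [folklore] -/
theorem hasDerivAt_flowAmb (U : GaugeConfig d L SU[n]) (t : ℝ) : HasDerivAt (flowAmb U) (vfAmb (flowAmb U t)) t := by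
  set T : ℝ≥0 := ⟨|t| + 2, by positivity⟩ with hTdef
  have hT : |t| < (T : ℝ) := by
    show |t| < |t| + 2
    linarith
  have heq : flowAmb U =ᶠ[𝓝 t] localFlow T (coeConfig U) := by
    have hmem : {s : ℝ | |s| < (T : ℝ)} ∈ 𝓝 t := (isOpen_lt continuous_abs continuous_const).mem_nhds hT
    filter_upwards [hmem] with s hs
    exact flowAmb_eq_localFlow U hs
  have ht : t ∈ Ioo (-(T : ℝ)) T := ⟨(abs_lt.1 hT).1, (abs_lt.1 hT).2⟩
  have hsol : HasDerivAt (localFlow T (coeConfig U)) (vfAmb (localFlow T (coeConfig U) t)) t :=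
    (hasDerivWithinAt_localFlow_vfAmb T U (Ioo_subset_Icc_self ht)).hasDerivAt (Icc_mem_nhds ht.1 ht.2)
  rw [flowAmb_eq_localFlow U hT]
  exact hsol.congr_of_eventuallyEq heq

/-- The global ambient flow line stays in `SU(n)^E`. [folklore] -/
theorem flowAmb_mem_SU (U : GaugeConfig d L SU[n]) (t : ℝ) (e : Edge d L) : flowAmb U t e ∈ SU[n] :=
  localFlow_mem_SU (Tof t) U (mem_Icc_of_abs_lt (abs_lt_Tof t)) e

/-- Initial condition of the global ambient flow line. [folklore] -/
theorem flowAmb_zero (U : GaugeConfig d L SU[n]) : flowAmb U 0 = coeConfig U :=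
  localFlow_zero (Tof 0) (coeConfig_mem_closedBall U)

/-- The global Wilson flow line through `U`, as a curve of `SU(n)` configurations. [folklore] -/
def flowLine (U : GaugeConfig d L SU[n]) (t : ℝ) : GaugeConfig d L SU[n] :=
  fun e => ⟨flowAmb U t e, flowAmb_mem_SU U t e⟩

/-- `flowLine` read in the ambient space is `flowAmb`. [folklore] -/
theorem coeConfig_flowLine (U : GaugeConfig d L SU[n]) (t : ℝ) : coeConfig (flowLine U t) = flowAmb U t := rfl

/-- **Global existence**: `flowLine U` is a Wilson flow line through `U`. [folklore] -/
theorem isWilsonFlowLine_flowLine (U : GaugeConfig d L SU[n]) : IsWilsonFlowLine U (flowLine U) := by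
  refine ⟨?_, fun t e i j => ?_⟩
  · apply coeConfig_injective
    rw [coeConfig_flowLine, flowAmb_zero]
  · have h := (hasDerivAt_pi.1 (hasDerivAt_flowAmb U t)) e
    rw [← coeConfig_flowLine, vfAmb_coeConfig] at h
    exact hasDerivAt_entry h i j

/-- **Global existence** of a Wilson flow line through every configuration. [cite: Luscher2010Trivializing, §3.2] -/
theorem exists_isWilsonFlowLine (U : GaugeConfig d L SU[n]) : ∃ V, IsWilsonFlowLine U V :=
  ⟨flowLine U, isWilsonFlowLine_flowLine U⟩

/-! ### Uniqueness -/

/-- The true vector field is Lipschitz on the ball `closedBall 0 ρ₀ ⊇ SU(n)^E`. [folklore] -/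
theorem exists_lipschitzOnWith_vfAmb :
    ∃ K, LipschitzOnWith K (vfAmb (d := d) (L := L) (n := n))
      (closedBall (0 : GaugeConfig d L (Matrix (Fin n) (Fin n) ℂ)) (ρ₀ d L n)) :=
  (contDiff_vfAmb (m := 1)).contDiffOn.exists_lipschitzOnWith one_ne_zero (convex_closedBall _ _)
    (isCompact_closedBall _ _)

omit [NeZero L] in
/-- A flow line, read in the ambient space, solves the ambient ODE. [folklore] -/
theorem hasDerivAt_coeConfig_of_isWilsonFlowLine {U : GaugeConfig d L SU[n]} {V : ℝ → GaugeConfig d L SU[n]}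
    (hV : IsWilsonFlowLine U V) (t : ℝ) :
    HasDerivAt (fun s => coeConfig (V s)) (vfAmb (coeConfig (V t))) t := by
  refine hasDerivAt_pi.2 fun e => ?_
  rw [vfAmb_coeConfig]
  exact hasDerivAt_of_entries fun i j => hV.2 t e i j

/-- **Uniqueness** of the global flow line through `U` (Grönwall). [cite: Luscher2010Trivializing, §3.2] -/
theorem flowLine_unique {U : GaugeConfig d L SU[n]} {V W : ℝ → GaugeConfig d L SU[n]}
    (hV : IsWilsonFlowLine U V) (hW : IsWilsonFlowLine U W) : V = W := by
  obtain ⟨K, hK⟩ := exists_lipschitzOnWith_vfAmb (d := d) (L := L) (n := n)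
  have key := ODE_solution_unique_univ (v := fun _ => vfAmb)
    (s := fun _ => closedBall (0 : GaugeConfig d L (Matrix (Fin n) (Fin n) ℂ)) (ρ₀ d L n)) (t₀ := 0)
    (fun _ => hK)
    (fun t => ⟨hasDerivAt_coeConfig_of_isWilsonFlowLine hV t, coeConfig_mem_closedBall _⟩)
    (fun t => ⟨hasDerivAt_coeConfig_of_isWilsonFlowLine hW t, coeConfig_mem_closedBall _⟩)
    (by simp only [hV.1, hW.1])
  funext t
  exact coeConfig_injective (congr_fun key t)

end Existence

end WilsonFlow

/-! ## The main theorems -/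

section API

variable [NeZero L]

open WilsonFlow
open scoped Matrix.Norms.Frobenius

/-- **Global existence**: `t ↦ wilsonFlow t U` is a Wilson flow line through `U`, i.e. `wilsonFlow 0 U = U` and
the flow equation holds (entrywise) at every `t ∈ ℝ` ("existence … at all positive and negative times")
[cite: Luscher2010, §1, after eq. (1.4)]. -/
theorem isWilsonFlowLine_wilsonFlow (U : GaugeConfig d L SU[n]) : IsWilsonFlowLine U (fun t => wilsonFlow t U) := by
  have h : ∃ V, IsWilsonFlowLine U V := exists_isWilsonFlowLine U
  have heq : (fun t => wilsonFlow t U) = h.choose := by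
    funext t
    exact dif_pos h
  rw [heq]
  exact h.choose_spec

/-- **Uniqueness**: any global flow line through `U` is `t ↦ wilsonFlow t U` [cite: Luscher2010, §1, after eq. (1.4)]. -/
theorem IsWilsonFlowLine.eq_wilsonFlow {U : GaugeConfig d L SU[n]} {V : ℝ → GaugeConfig d L SU[n]}
    (hV : IsWilsonFlowLine U V) (t : ℝ) : V t = wilsonFlow t U :=
  congr_fun (flowLine_unique hV (isWilsonFlowLine_wilsonFlow U)) t

/-- Two flow lines through the same configuration coincide. [cite: Luscher2010Trivializing, §3.2] -/
theorem IsWilsonFlowLine.unique {U : GaugeConfig d L SU[n]} {V W : ℝ → GaugeConfig d L SU[n]}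
    (hV : IsWilsonFlowLine U V) (hW : IsWilsonFlowLine U W) : V = W :=
  flowLine_unique hV hW

/-- **The flow equation** `d/dt V_t(e) = −P(Ω_e(V_t)) V_t(e)` for `V_t = wilsonFlow t U`, entrywise, at every real
time `t` [cite: Luscher2010, eq. (1.4)]. -/
theorem hasDerivAt_wilsonFlow (U : GaugeConfig d L SU[n]) (t : ℝ) (e : Edge d L) (i j : Fin n) :
    HasDerivAt (fun s : ℝ => ((wilsonFlow s U e : SU[n]) : Matrix (Fin n) (Fin n) ℂ) i j)
      (wilsonFlowVF (wilsonFlow t U) e i j) t :=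
  (isWilsonFlowLine_wilsonFlow U).2 t e i j

/-- `t ↦ wilsonFlow t U e` is continuous (indeed differentiable) as a matrix-valued curve, entrywise. [folklore] -/
theorem continuous_wilsonFlow_apply (U : GaugeConfig d L SU[n]) (e : Edge d L) (i j : Fin n) :
    Continuous (fun s : ℝ => ((wilsonFlow s U e : SU[n]) : Matrix (Fin n) (Fin n) ℂ) i j) :=
  continuous_iff_continuousAt.2 fun t => (hasDerivAt_wilsonFlow U t e i j).continuousAt

/-- **Group law** `V_{s+t} = V_s ∘ V_t` of the Wilson flow (both sides are flow lines through `V_t U`). [folklore] -/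
theorem wilsonFlow_add (s t : ℝ) (U : GaugeConfig d L SU[n]) :
    wilsonFlow (s + t) U = wilsonFlow s (wilsonFlow t U) := by
  have h : IsWilsonFlowLine (wilsonFlow t U) (fun s => wilsonFlow (s + t) U) := by
    refine ⟨by simp only [zero_add], fun s e i j => ?_⟩
    exact (hasDerivAt_wilsonFlow U (s + t) e i j).comp_add_const s t
  exact h.eq_wilsonFlow s

/-- The Wilson flow is invertible: `V_{-t} (V_t U) = U`. [folklore] -/
theorem wilsonFlow_neg_wilsonFlow (t : ℝ) (U : GaugeConfig d L SU[n]) :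
    wilsonFlow (-t) (wilsonFlow t U) = U := by
  rw [← wilsonFlow_add, neg_add_cancel, wilsonFlow_zero]

/-- **The route predicate holds**: `wilsonFlow` is "a solution `B` of Lüscher's lattice flow with `B 0 U = U`" in
the exact inline sense of items `FlowedEnergyUVBound` / `LatticeFlowEpsilonRegularity`. [cite: Luscher2010, eq. (1.4)] -/
theorem isWilsonFlowSolution_wilsonFlow : IsWilsonFlowSolution (wilsonFlow (d := d) (L := L) (n := n)) :=
  ⟨wilsonFlow_zero, fun U y μ τ _ i j => hasDerivAt_wilsonFlow U τ (y, μ) i j⟩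

/-- **Forward uniqueness for the route predicate**: any family `B` satisfying the route's inline predicate agrees
with `wilsonFlow` at all `t ≥ 0` (Grönwall on `[0, t]`; the predicate says nothing about `t < 0`). Hence the items
can be restated over `wilsonFlow` with the same meaning. [folklore] -/
theorem IsWilsonFlowSolution.eq_wilsonFlow {B : ℝ → GaugeConfig d L SU[n] → GaugeConfig d L SU[n]}
    (hB : IsWilsonFlowSolution B) {t : ℝ} (ht : 0 ≤ t) (U : GaugeConfig d L SU[n]) : B t U = wilsonFlow t U := by
  obtain ⟨K, hK⟩ := exists_lipschitzOnWith_vfAmb (d := d) (L := L) (n := n)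
  have hf : ∀ s : ℝ, 0 ≤ s → HasDerivAt (fun s => coeConfig (B s U)) (vfAmb (coeConfig (B s U))) s := by
    intro s hs
    refine hasDerivAt_pi.2 fun e => ?_
    obtain ⟨y, μ⟩ := e
    rw [vfAmb_coeConfig]
    exact hasDerivAt_of_entries fun i j => hB.2 U y μ s hs i j
  have hg := fun s => hasDerivAt_coeConfig_of_isWilsonFlowLine (isWilsonFlowLine_wilsonFlow U) s
  have key := ODE_solution_unique_of_mem_Icc_right (v := fun _ => vfAmb)
    (s := fun _ => closedBall (0 : GaugeConfig d L (Matrix (Fin n) (Fin n) ℂ)) (ρ₀ d L n)) (K := K)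
    (f := fun s => coeConfig (B s U)) (g := fun s => coeConfig (wilsonFlow s U)) (a := 0) (b := t)
    (fun _ _ => hK)
    (fun s hs => (hf s hs.1).continuousAt.continuousWithinAt)
    (fun s hs => (hf s hs.1).hasDerivWithinAt)
    (fun s _ => coeConfig_mem_closedBall _)
    (fun s _ => (hg s).continuousAt.continuousWithinAt)
    (fun s _ => (hg s).hasDerivWithinAt)
    (fun s _ => coeConfig_mem_closedBall _)
    (by simp only [hB.1 U, wilsonFlow_zero])
    ⟨ht, le_rfl⟩
  exact coeConfig_injective key

/-- **Stationary points**: a configuration at which the vector field vanishes (a critical point of `S_w`, e.g. any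
configuration with `P(Ω_e(U)) = 0` for all links) is fixed by the flow. [folklore] -/
theorem wilsonFlow_eq_self_of_wilsonFlowVF_eq_zero {U : GaugeConfig d L SU[n]} (h : ∀ e, wilsonFlowVF U e = 0) (t : ℝ) :
    wilsonFlow t U = U := by
  have hc : IsWilsonFlowLine U (fun _ => U) := by
    refine ⟨rfl, fun t e i j => ?_⟩
    rw [h e]
    exact hasDerivAt_const t _
  exact (hc.eq_wilsonFlow t).symm

/-! ### Gauge covariance -/

omit [NeZero L] in
/-- The neighbour of `x − ν̂` in direction `ν` is `x`. [folklore] -/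
theorem shift_sub_single (x : Site d L) (ν : Fin d) : (x - Pi.single ν 1).shift ν = x :=
  sub_add_cancel x _

omit [NeZero L] in
/-- `Ω_{x,μ}` transforms by conjugation at the base point: `Ω_{x,μ}(V^g) = g(x) Ω_{x,μ}(V) g(x)ᴴ` (every loop in the
sum starts and ends at `x`). [folklore] -/
theorem plaquetteLoopSum_gaugeTransform (g : Site d L → SU[n]) (V : GaugeConfig d L SU[n]) (x : Site d L) (μ : Fin d) :
    plaquetteLoopSum (gaugeTransform g V) x μ =
      ((g x : SU[n]) : Matrix (Fin n) (Fin n) ℂ) * plaquetteLoopSum V x μ * ((g x : SU[n]) : Matrix (Fin n) (Fin n) ℂ)ᴴ := by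
  unfold plaquetteLoopSum
  rw [Finset.mul_sum, Finset.sum_mul]
  refine Finset.sum_congr rfl fun ν _ => ?_
  split_ifs with h
  · simp
  · rw [Matrix.mul_add, Matrix.add_mul]
    congr 1
    · rw [QuantumLattice.plaquetteHolonomy_gaugeTransform, coe_mul_SU, coe_mul_SU, coe_inv_SU]
    · have key : (gaugeTransform g V (x - Pi.single ν 1, ν))⁻¹ *
            plaquetteHolonomy (gaugeTransform g V) (x - Pi.single ν 1) ν μ * gaugeTransform g V (x - Pi.single ν 1, ν) =
          g x * ((V (x - Pi.single ν 1, ν))⁻¹ * plaquetteHolonomy V (x - Pi.single ν 1) ν μ * V (x - Pi.single ν 1, ν)) *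
            (g x)⁻¹ := by
        rw [QuantumLattice.plaquetteHolonomy_gaugeTransform]
        simp only [gaugeTransform, shift_sub_single]
        group
      rw [key, coe_mul_SU, coe_mul_SU, coe_inv_SU]

/-- `Aᴴ (A M) = M` for `A ∈ SU(n)`. [folklore] -/
theorem conjTranspose_mul_self_mul_SU (A : SU[n]) (M : Matrix (Fin n) (Fin n) ℂ) :
    (A : Matrix (Fin n) (Fin n) ℂ)ᴴ * ((A : Matrix (Fin n) (Fin n) ℂ) * M) = M := by
  rw [← Matrix.mul_assoc, conjTranspose_mul_self_SU, Matrix.one_mul]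

omit [NeZero L] in
/-- **Gauge covariance of the vector field**: `Z(V^g)(x,μ) = g(x) Z(V)(x,μ) g(x+μ̂)ᴴ` (`P` commutes with unitary
conjugation, `suProj_unitary_conj`). [cite: Luscher2010, §2.1] -/
theorem wilsonFlowVF_gaugeTransform (g : Site d L → SU[n]) (V : GaugeConfig d L SU[n]) (e : Edge d L) :
    wilsonFlowVF (gaugeTransform g V) e =
      ((g e.1 : SU[n]) : Matrix (Fin n) (Fin n) ℂ) * wilsonFlowVF V e *
        ((g (e.1.shift e.2) : SU[n]) : Matrix (Fin n) (Fin n) ℂ)ᴴ := by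
  obtain ⟨x, μ⟩ := e
  have hg : ((g x : SU[n]) : Matrix (Fin n) (Fin n) ℂ) ∈ Matrix.unitaryGroup (Fin n) ℂ := (g x).2.1
  simp only [wilsonFlowVF]
  rw [plaquetteLoopSum_gaugeTransform, ← Matrix.star_eq_conjTranspose, suProj_unitary_conj hg]
  simp only [gaugeTransform, coe_mul_SU, coe_inv_SU, Matrix.star_eq_conjTranspose, neg_mul, Matrix.mul_neg,
    Matrix.mul_assoc, conjTranspose_mul_self_mul_SU]

/-- **Gauge covariance of the Wilson flow**: `V_t(U^g) = (V_t U)^g` for every gauge transformation `g : Λ → SU(n)`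
("the flow equation is invariant under `t`-independent gauge transformations"). [cite: Luscher2010, §2.1] -/
theorem wilsonFlow_gaugeTransform (g : Site d L → SU[n]) (t : ℝ) (U : GaugeConfig d L SU[n]) :
    wilsonFlow t (gaugeTransform g U) = gaugeTransform g (wilsonFlow t U) := by
  have h : IsWilsonFlowLine (gaugeTransform g U) (fun t => gaugeTransform g (wilsonFlow t U)) := by
    refine ⟨by simp only [wilsonFlow_zero], fun t e i j => ?_⟩
    have hW : HasDerivAt (fun s => ((wilsonFlow s U e : SU[n]) : Matrix (Fin n) (Fin n) ℂ))
        (wilsonFlowVF (wilsonFlow t U) e) t :=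
      hasDerivAt_of_entries fun i j => hasDerivAt_wilsonFlow U t e i j
    have h2 := (hW.const_mul ((g e.1 : SU[n]) : Matrix (Fin n) (Fin n) ℂ)).mul_const
      (((g (e.1.shift e.2) : SU[n]) : Matrix (Fin n) (Fin n) ℂ)ᴴ)
    rw [← wilsonFlowVF_gaugeTransform] at h2
    exact hasDerivAt_entry h2 i j
  exact (h.eq_wilsonFlow t).symm

/-! ### Translation covariance -/

/-- Lattice translation of a configuration on the torus: `(U.siteTranslate a)(x, μ) = U(x + a, μ)`. [folklore] -/
def GaugeConfig.siteTranslate {G : Type*} (a : Site d L) (U : GaugeConfig d L G) : GaugeConfig d L G :=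
  fun e => U (e.1 + a, e.2)

omit [NeZero L] in
/-- `siteTranslate` evaluated. [folklore] -/
@[simp] theorem GaugeConfig.siteTranslate_apply {G : Type*} (a : Site d L) (U : GaugeConfig d L G) (e : Edge d L) :
    U.siteTranslate a e = U (e.1 + a, e.2) := rfl

omit [NeZero L] in
/-- Plaquette holonomies of a translated configuration. [folklore] -/
theorem plaquetteHolonomy_siteTranslate {G : Type*} [Group G] (a : Site d L) (U : GaugeConfig d L G) (x : Site d L)
    (i j : Fin d) : plaquetteHolonomy (U.siteTranslate a) x i j = plaquetteHolonomy U (x + a) i j := by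
  simp only [plaquetteHolonomy, GaugeConfig.siteTranslate_apply, Site.shift, add_right_comm _ _ a]

omit [NeZero L] in
/-- `Ω` of a translated configuration. [folklore] -/
theorem plaquetteLoopSum_siteTranslate (a : Site d L) (V : GaugeConfig d L SU[n]) (x : Site d L) (μ : Fin d) :
    plaquetteLoopSum (V.siteTranslate a) x μ = plaquetteLoopSum V (x + a) μ := by
  unfold plaquetteLoopSum
  simp only [plaquetteHolonomy_siteTranslate, GaugeConfig.siteTranslate_apply, sub_add_eq_add_sub]

omit [NeZero L] in
/-- The vector field commutes with translations. [folklore] -/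
theorem wilsonFlowVF_siteTranslate (a : Site d L) (V : GaugeConfig d L SU[n]) (e : Edge d L) :
    wilsonFlowVF (V.siteTranslate a) e = wilsonFlowVF V (e.1 + a, e.2) := by
  obtain ⟨x, μ⟩ := e
  simp only [wilsonFlowVF, plaquetteLoopSum_siteTranslate, GaugeConfig.siteTranslate_apply]

/-- **Translation covariance of the Wilson flow**: `V_t(τ_a U) = τ_a (V_t U)`. [folklore] -/
theorem wilsonFlow_siteTranslate (a : Site d L) (t : ℝ) (U : GaugeConfig d L SU[n]) :
    wilsonFlow t (U.siteTranslate a) = (wilsonFlow t U).siteTranslate a := by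
  have h : IsWilsonFlowLine (U.siteTranslate a) (fun t => (wilsonFlow t U).siteTranslate a) := by
    refine ⟨by simp only [wilsonFlow_zero], fun t e i j => ?_⟩
    rw [wilsonFlowVF_siteTranslate]
    exact hasDerivAt_wilsonFlow U t (e.1 + a, e.2) i j
  exact (h.eq_wilsonFlow t).symm

/-! ### Continuity and measurability in the initial condition -/

/-- **Continuous dependence on the initial field**: `U ↦ wilsonFlow t U` is continuous (it is Lipschitz in the
ambient matrix norm, by Grönwall). [folklore] -/
theorem continuous_wilsonFlow (t : ℝ) : Continuous (wilsonFlow (d := d) (L := L) (n := n) t) := by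
  set T : ℝ≥0 := ⟨|t| + 2, by positivity⟩ with hTdef
  have hT : |t| < (T : ℝ) := by
    show |t| < |t| + 2
    linarith
  obtain ⟨L', hL'⟩ := exists_lipschitzOnWith_localFlow (d := d) (L := L) (n := n) T
  have hcont : Continuous fun U : GaugeConfig d L SU[n] => localFlow T (coeConfig U) t :=
    (hL' t (mem_Icc_of_abs_lt hT)).continuousOn.comp_continuous continuous_coeConfig
      fun U => coeConfig_mem_closedBall U
  have heq : wilsonFlow (d := d) (L := L) (n := n) t = fun U => localFlowSU T U t (mem_Icc_of_abs_lt hT) := by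
    funext U
    rw [← (isWilsonFlowLine_flowLine U).eq_wilsonFlow t]
    apply coeConfig_injective
    rw [coeConfig_flowLine, coeConfig_localFlowSU, flowAmb_eq_localFlow U hT]
  rw [heq]
  exact continuous_pi fun e => Continuous.subtype_mk ((continuous_apply e).comp hcont) _

/-- `U ↦ wilsonFlow t U` is Borel measurable. [folklore] -/
theorem measurable_wilsonFlow (t : ℝ) : Measurable (wilsonFlow (d := d) (L := L) (n := n) t) := by
  haveI : SecondCountableTopology (Matrix (Fin n) (Fin n) ℂ) :=
    inferInstanceAs (SecondCountableTopology (Fin n → Fin n → ℂ))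
  haveI : SecondCountableTopology SU[n] := Topology.IsEmbedding.subtypeVal.secondCountableTopology
  exact (continuous_wilsonFlow t).measurable

/-- **Joint continuity** of `(t, U) ↦ wilsonFlow t U` (local flows are jointly continuous, Mathlib's
`continuousOn_prod_of_continuousOn_lipschitzOnWith`, and `wilsonFlow` is locally one of them). [folklore] -/
theorem continuous_wilsonFlow_uncurry :
    Continuous (fun p : ℝ × GaugeConfig d L SU[n] => wilsonFlow p.1 p.2) := by
  refine continuous_iff_continuousAt.2 fun p => ?_
  set T : ℝ≥0 := ⟨|p.1| + 2, by positivity⟩ with hTdef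
  have hT : |p.1| < (T : ℝ) := by
    show |p.1| < |p.1| + 2
    linarith
  have hTT : -(T : ℝ) ≤ T := by linarith [T.coe_nonneg]
  obtain ⟨L', hL'⟩ := exists_lipschitzOnWith_localFlow (d := d) (L := L) (n := n) T
  have hco : ContinuousOn (fun q : GaugeConfig d L (Matrix (Fin n) (Fin n) ℂ) × ℝ => localFlow T q.1 q.2)
      (closedBall (0 : GaugeConfig d L (Matrix (Fin n) (Fin n) ℂ)) (ρ₀ d L n) ×ˢ Icc (-(T : ℝ)) T) :=
    continuousOn_prod_of_continuousOn_lipschitzOnWith _ L'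
      (fun x hx => HasDerivWithinAt.continuousOn fun t ht => hasDerivWithinAt_localFlow T hx ht) hL'
  -- a clamped time, so that the local flow can be composed with a globally defined continuous map
  set clampT : ℝ → ℝ := fun t => max (-(T : ℝ)) (min (T : ℝ) t) with hclamp
  have hclamp_mem : ∀ t, clampT t ∈ Icc (-(T : ℝ)) T := fun t => ⟨le_max_left _ _, max_le hTT (min_le_left _ _)⟩
  have hclamp_eq : ∀ t, |t| < (T : ℝ) → clampT t = t := fun t ht => by
    have h1 := abs_lt.1 ht
    simp only [hclamp, min_eq_right h1.2.le, max_eq_right h1.1.le]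
  have hg : Continuous fun q : ℝ × GaugeConfig d L SU[n] => localFlow T (coeConfig q.2) (clampT q.1) := by
    have hf : Continuous fun q : ℝ × GaugeConfig d L SU[n] => (coeConfig q.2, clampT q.1) :=
      (continuous_coeConfig.comp continuous_snd).prodMk
        ((continuous_const.max (continuous_const.min continuous_id)).comp continuous_fst)
    exact hco.comp_continuous hf fun q => ⟨coeConfig_mem_closedBall q.2, hclamp_mem q.1⟩
  have hnhds : ∀ᶠ q in 𝓝 p, coeConfig (wilsonFlow q.1 q.2) = localFlow T (coeConfig q.2) (clampT q.1) := by
    have hmem : {q : ℝ × GaugeConfig d L SU[n] | |q.1| < (T : ℝ)} ∈ 𝓝 p :=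
      (isOpen_lt (continuous_abs.comp continuous_fst) continuous_const).mem_nhds hT
    filter_upwards [hmem] with q hq
    rw [hclamp_eq q.1 hq, ← (isWilsonFlowLine_flowLine q.2).eq_wilsonFlow q.1, coeConfig_flowLine,
      flowAmb_eq_localFlow q.2 hq]
  refine continuousAt_pi.2 fun e => ?_
  rw [Topology.IsInducing.subtypeVal.continuousAt_iff]
  have h3 : ContinuousAt (fun q : ℝ × GaugeConfig d L SU[n] => localFlow T (coeConfig q.2) (clampT q.1) e) p :=
    ((continuous_apply e).comp hg).continuousAt
  refine h3.congr ?_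
  filter_upwards [hnhds] with q hq
  show localFlow T (coeConfig q.2) (clampT q.1) e = ((wilsonFlow q.1 q.2 e : SU[n]) : Matrix (Fin n) (Fin n) ℂ)
  rw [← coeConfig_apply (wilsonFlow q.1 q.2) e, hq]

/-! ### Stationary configurations -/

omit [NeZero L] in
/-- `P` kills Hermitian matrices. [folklore] -/
theorem suProj_eq_zero_of_conjTranspose_eq {W : Matrix (Fin n) (Fin n) ℂ} (h : Wᴴ = W) : suProj W = 0 := by
  simp only [suProj, h, sub_self, smul_zero, Matrix.trace_zero, mul_zero, zero_smul]

omit [NeZero L] in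
/-- For a flat configuration (all plaquette holonomies trivial) every `Ω_{x,μ}` is a sum of identity matrices, hence
Hermitian, so the vector field vanishes. [folklore] -/
theorem wilsonFlowVF_eq_zero_of_flat {U : GaugeConfig d L SU[n]} (hU : ∀ x μ ν, μ ≠ ν → plaquetteHolonomy U x μ ν = 1)
    (e : Edge d L) : wilsonFlowVF U e = 0 := by
  obtain ⟨x, μ⟩ := e
  have hΩ : (plaquetteLoopSum U x μ)ᴴ = plaquetteLoopSum U x μ := by
    unfold plaquetteLoopSum
    rw [Matrix.conjTranspose_sum]
    refine Finset.sum_congr rfl fun ν _ => ?_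
    split_ifs with h
    · exact Matrix.conjTranspose_zero
    · rw [hU x μ ν (Ne.symm h), hU (x - Pi.single ν 1) ν μ h, mul_one, inv_mul_cancel]
      simp
  rw [wilsonFlowVF_apply, suProj_eq_zero_of_conjTranspose_eq hΩ, neg_zero, Matrix.zero_mul]

/-- **Flat configurations are stationary** under the Wilson flow (they are absolute minima of `S_w`). [folklore] -/
theorem wilsonFlow_eq_self_of_flat {U : GaugeConfig d L SU[n]} (hU : ∀ x μ ν, μ ≠ ν → plaquetteHolonomy U x μ ν = 1)
    (t : ℝ) : wilsonFlow t U = U :=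
  wilsonFlow_eq_self_of_wilsonFlowVF_eq_zero (wilsonFlowVF_eq_zero_of_flat hU) t

/-! ### The action along the flow: trace algebra and re-indexing -/

namespace WilsonFlow

/-- The trace as a continuous real-linear functional (Frobenius norm). [folklore] -/
def traceCLM : Matrix (Fin n) (Fin n) ℂ →L[ℝ] ℂ :=
  LinearMap.toContinuousLinearMap (Matrix.traceLinearMap (Fin n) ℝ ℂ)

/-- `traceCLM M = tr M`. [folklore] -/
@[simp] theorem traceCLM_apply (M : Matrix (Fin n) (Fin n) ℂ) : traceCLM M = M.trace := rfl

/-- `Re tr Mᴴ = Re tr M`. [folklore] -/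
theorem re_trace_conjTranspose (M : Matrix (Fin n) (Fin n) ℂ) : Mᴴ.trace.re = M.trace.re := by
  rw [Matrix.trace_conjTranspose, Complex.star_def, Complex.conj_re]

/-- The trace algebra behind `d/dt Re tr U_p`: the real trace of the product-rule derivative of
`A₁ A₂ A₃ᴴ A₄ᴴ` with `Ȧₖ = −Xₖ Aₖ` is minus the sum over the four links of `Re tr (Xₖ · loop starting at link k)`.
[folklore] -/
theorem re_trace_plaquette_deriv (X₁ X₂ X₃ X₄ A₁ A₂ A₃ A₄ : Matrix (Fin n) (Fin n) ℂ) :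
    (((-X₁ * A₁ * A₂ + A₁ * (-X₂ * A₂)) * star A₃ + A₁ * A₂ * star (-X₃ * A₃)) * star A₄ +
        A₁ * A₂ * star A₃ * star (-X₄ * A₄)).trace.re =
      -((X₁ * (A₁ * A₂ * A₃ᴴ * A₄ᴴ)).trace.re + (X₂ * (A₂ * A₃ᴴ * A₄ᴴ * A₁)).trace.re +
        (X₃ * (A₃ * A₂ᴴ * A₁ᴴ * A₄)).trace.re + (X₄ * (A₄ * A₃ * A₂ᴴ * A₁ᴴ)).trace.re) := by
  have T2 : (A₁ * (X₂ * (A₂ * (A₃ᴴ * A₄ᴴ)))).trace.re = (X₂ * (A₂ * (A₃ᴴ * (A₄ᴴ * A₁)))).trace.re := by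
    rw [Matrix.trace_mul_comm]
    simp only [Matrix.mul_assoc]
  have T3 : (A₁ * (A₂ * (A₃ᴴ * (X₃ᴴ * A₄ᴴ)))).trace.re = (X₃ * (A₃ * (A₂ᴴ * (A₁ᴴ * A₄)))).trace.re := by
    rw [← re_trace_conjTranspose (A₁ * (A₂ * (A₃ᴴ * (X₃ᴴ * A₄ᴴ))))]
    simp only [Matrix.conjTranspose_mul, Matrix.conjTranspose_conjTranspose, Matrix.mul_assoc]
    rw [Matrix.trace_mul_comm]
    simp only [Matrix.mul_assoc]
  have T4 : (A₁ * (A₂ * (A₃ᴴ * (A₄ᴴ * X₄ᴴ)))).trace.re = (X₄ * (A₄ * (A₃ * (A₂ᴴ * A₁ᴴ)))).trace.re := by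
    rw [← re_trace_conjTranspose (A₁ * (A₂ * (A₃ᴴ * (A₄ᴴ * X₄ᴴ))))]
    simp only [Matrix.conjTranspose_mul, Matrix.conjTranspose_conjTranspose, Matrix.mul_assoc]
  simp only [Matrix.star_eq_conjTranspose, Matrix.conjTranspose_mul, Matrix.conjTranspose_neg, Matrix.add_mul,
    neg_mul, mul_neg, Matrix.trace_add, Matrix.trace_neg, Complex.add_re, Complex.neg_re, Matrix.mul_assoc]
  rw [T2, T3, T4]
  ring

/-- The anti-Hermitian field `X_e(V) = P(Ω_e(V))` of a configuration. [folklore] -/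
def Xf (V : GaugeConfig d L SU[n]) (e : Edge d L) : Matrix (Fin n) (Fin n) ℂ :=
  suProj (plaquetteLoopSum V e.1 e.2)

/-- `Re tr (X_{y,a} · upper loop (y,a,b))`. [folklore] -/
def upTerm (V : GaugeConfig d L SU[n]) (y : Site d L) (a b : Fin d) : ℝ :=
  (Xf V (y, a) * ((plaquetteHolonomy V y a b : SU[n]) : Matrix (Fin n) (Fin n) ℂ)).trace.re

/-- `Re tr (X_{y,a} · lower loop (y,a,b))`. [folklore] -/
def loTerm (V : GaugeConfig d L SU[n]) (y : Site d L) (a b : Fin d) : ℝ :=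
  (Xf V (y, a) * (((V (y - Pi.single b 1, b))⁻¹ * plaquetteHolonomy V (y - Pi.single b 1) b a * V (y - Pi.single b 1, b) :
    SU[n]) : Matrix (Fin n) (Fin n) ℂ)).trace.re

omit [NeZero L] in
/-- `x + μ̂ − μ̂ = x`. [folklore] -/
theorem shift_sub_self (x : Site d L) (μ : Fin d) : x.shift μ - Pi.single μ 1 = x :=
  add_sub_cancel_right x _

/-- **Derivative of one plaquette** along the flow: `d/dt Re tr U_p(V_t) = −∑_{links e of p} Re tr (X_e · loop from e)`.
[folklore] -/
theorem hasDerivAt_re_trace_plaquetteHolonomy (U : GaugeConfig d L SU[n]) (t : ℝ) (x : Site d L) (μ ν : Fin d) :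
    HasDerivAt (fun s => (((plaquetteHolonomy (wilsonFlow s U) x μ ν : SU[n]) : Matrix (Fin n) (Fin n) ℂ)).trace.re)
      (-(upTerm (wilsonFlow t U) x μ ν + loTerm (wilsonFlow t U) (x.shift μ) ν μ +
          loTerm (wilsonFlow t U) (x.shift ν) μ ν + upTerm (wilsonFlow t U) x ν μ)) t := by
  have hW : ∀ e : Edge d L, HasDerivAt (fun s => ((wilsonFlow s U e : SU[n]) : Matrix (Fin n) (Fin n) ℂ))
      (-Xf (wilsonFlow t U) e * ((wilsonFlow t U e : SU[n]) : Matrix (Fin n) (Fin n) ℂ)) t := fun e =>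
    hasDerivAt_of_entries fun i j => hasDerivAt_wilsonFlow U t e i j
  have h := (((hW (x, μ)).fun_mul (hW (x.shift μ, ν))).fun_mul (hW (x.shift ν, μ)).star).fun_mul (hW (x, ν)).star
  have hfun : (fun s => (((plaquetteHolonomy (wilsonFlow s U) x μ ν : SU[n]) : Matrix (Fin n) (Fin n) ℂ))) =
      fun s => ((wilsonFlow s U (x, μ) : SU[n]) : Matrix (Fin n) (Fin n) ℂ) *
        ((wilsonFlow s U (x.shift μ, ν) : SU[n]) : Matrix (Fin n) (Fin n) ℂ) *
        star ((wilsonFlow s U (x.shift ν, μ) : SU[n]) : Matrix (Fin n) (Fin n) ℂ) *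
        star ((wilsonFlow s U (x, ν) : SU[n]) : Matrix (Fin n) (Fin n) ℂ) := by
    funext s
    simp only [plaquetteHolonomy, coe_mul_SU, coe_inv_SU, Matrix.star_eq_conjTranspose]
  have htr := Complex.reCLM.hasFDerivAt.comp_hasDerivAt t (traceCLM.hasFDerivAt.comp_hasDerivAt t h)
  rw [← hfun] at htr
  refine htr.congr_deriv ?_
  show (_ : Matrix (Fin n) (Fin n) ℂ).trace.re = _
  rw [re_trace_plaquette_deriv]
  unfold upTerm loTerm
  rw [shift_sub_self, shift_sub_self]
  have g2 : (wilsonFlow t U (x, μ))⁻¹ * plaquetteHolonomy (wilsonFlow t U) x μ ν * wilsonFlow t U (x, μ) =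
      wilsonFlow t U (x.shift μ, ν) * (wilsonFlow t U (x.shift ν, μ))⁻¹ * (wilsonFlow t U (x, ν))⁻¹ * wilsonFlow t U (x, μ) := by
    simp only [plaquetteHolonomy]
    group
  have g3 : (wilsonFlow t U (x, ν))⁻¹ * plaquetteHolonomy (wilsonFlow t U) x ν μ * wilsonFlow t U (x, ν) =
      wilsonFlow t U (x.shift ν, μ) * (wilsonFlow t U (x.shift μ, ν))⁻¹ * (wilsonFlow t U (x, μ))⁻¹ * wilsonFlow t U (x, ν) := by
    simp only [plaquetteHolonomy]
    group
  rw [g2, g3]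
  simp only [plaquetteHolonomy, coe_mul_SU, coe_inv_SU]

/-- **Derivative of the Wilson action** along the flow, plaquette by plaquette. [folklore] -/
theorem hasDerivAt_wilsonAction_wilsonFlow_plaquettes (U : GaugeConfig d L SU[n]) (t : ℝ) :
    HasDerivAt (fun s => wilsonAction (QuantumLattice.fundamentalRep (Fin n)) (wilsonFlow s U))
      (∑ p : Plaquette d L, (upTerm (wilsonFlow t U) p.1 p.2.1.1 p.2.1.2 +
          loTerm (wilsonFlow t U) (p.1.shift p.2.1.1) p.2.1.2 p.2.1.1 +
          loTerm (wilsonFlow t U) (p.1.shift p.2.1.2) p.2.1.1 p.2.1.2 + upTerm (wilsonFlow t U) p.1 p.2.1.2 p.2.1.1)) t := by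
  have h := HasDerivAt.fun_sum (u := (Finset.univ : Finset (Plaquette d L))) fun p _ =>
    (hasDerivAt_re_trace_plaquetteHolonomy U t p.1 p.2.1.1 p.2.1.2).const_sub (n : ℝ)
  simp only [neg_neg] at h
  exact h

omit [NeZero L] in
/-- Expanding `Ω`: `Re tr (X_{y,a} Ω_{y,a}) = ∑_{b ≠ a} (upTerm + loTerm)`. [folklore] -/
theorem re_trace_Xf_mul_loopSum (V : GaugeConfig d L SU[n]) (y : Site d L) (a : Fin d) :
    (Xf V (y, a) * plaquetteLoopSum V y a).trace.re = ∑ b, if b = a then (0 : ℝ) else (upTerm V y a b + loTerm V y a b) := by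
  unfold plaquetteLoopSum upTerm loTerm
  rw [Matrix.mul_sum, Matrix.trace_sum, Complex.re_sum]
  refine Finset.sum_congr rfl fun b _ => ?_
  split_ifs with h
  · rw [Matrix.mul_zero, Matrix.trace_zero, Complex.zero_re]
  · rw [Matrix.mul_add, Matrix.trace_add, Complex.add_re]

omit [NeZero L] in
/-- Off-diagonal pairs: `∑_{a} ∑_{b ≠ a} h a b = ∑_{a<b} (h a b + h b a)`. [folklore] -/
theorem sum_offDiag_eq_sum_lt (h : Fin d → Fin d → ℝ) :
    ∑ a, ∑ b, (if b = a then (0 : ℝ) else h a b) =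
      ∑ q : {q : Fin d × Fin d // q.1 < q.2}, (h q.1.1 q.1.2 + h q.1.2 q.1.1) := by
  classical
  rw [← Finset.sum_product' (f := fun a b => if b = a then (0 : ℝ) else h a b), Finset.univ_product_univ]
  rw [← Finset.sum_filter_add_sum_filter_not Finset.univ (fun q : Fin d × Fin d => q.1 < q.2)]
  rw [← Finset.sum_filter_add_sum_filter_not (Finset.univ.filter fun q : Fin d × Fin d => ¬q.1 < q.2)
    (fun q : Fin d × Fin d => q.2 < q.1)]
  have hdiag : ∑ q ∈ (Finset.univ.filter fun q : Fin d × Fin d => ¬q.1 < q.2).filter (fun q => ¬q.2 < q.1),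
      (if q.2 = q.1 then (0 : ℝ) else h q.1 q.2) = 0 := by
    refine Finset.sum_eq_zero fun q hq => ?_
    simp only [Finset.mem_filter, Finset.mem_univ, true_and, not_lt] at hq
    rw [if_pos (le_antisymm hq.1 hq.2)]
  have hlt : ∑ q ∈ Finset.univ.filter (fun q : Fin d × Fin d => q.1 < q.2), (if q.2 = q.1 then (0 : ℝ) else h q.1 q.2) =
      ∑ q : {q : Fin d × Fin d // q.1 < q.2}, h q.1.1 q.1.2 := by
    rw [Finset.sum_subtype (Finset.univ.filter fun q : Fin d × Fin d => q.1 < q.2) (p := fun q : Fin d × Fin d => q.1 < q.2)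
      (fun q => by simp)]
    refine Finset.sum_congr rfl fun q _ => ?_
    rw [if_neg (ne_of_gt q.2)]
  have hgt : ∑ q ∈ (Finset.univ.filter fun q : Fin d × Fin d => ¬q.1 < q.2).filter (fun q => q.2 < q.1),
      (if q.2 = q.1 then (0 : ℝ) else h q.1 q.2) = ∑ q : {q : Fin d × Fin d // q.1 < q.2}, h q.1.2 q.1.1 := by
    have hset : (Finset.univ.filter fun q : Fin d × Fin d => ¬q.1 < q.2).filter (fun q => q.2 < q.1) =
        (Finset.univ.filter fun q : Fin d × Fin d => q.1 < q.2).map (Equiv.prodComm (Fin d) (Fin d)).toEmbedding := by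
      ext q
      simp only [Finset.mem_filter, Finset.mem_univ, true_and, Finset.mem_map_equiv, Equiv.prodComm_symm,
        Equiv.prodComm_apply, Prod.fst_swap, Prod.snd_swap]
      exact ⟨fun hq => hq.2, fun hq => ⟨not_lt.2 hq.le, hq⟩⟩
    rw [hset, Finset.sum_map]
    rw [Finset.sum_subtype (Finset.univ.filter fun q : Fin d × Fin d => q.1 < q.2) (p := fun q : Fin d × Fin d => q.1 < q.2)
      (fun q => by simp)]
    refine Finset.sum_congr rfl fun q _ => ?_
    simp only [Equiv.coe_toEmbedding, Equiv.prodComm_apply, Prod.fst_swap, Prod.snd_swap]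
    rw [if_neg (ne_of_lt q.2)]
  rw [hlt, hgt, hdiag, add_zero, ← Finset.sum_add_distrib]

/-- Translation invariance of sums over the torus: `∑_x f(x + μ̂) = ∑_x f(x)`. [folklore] -/
theorem sum_shift (f : Site d L → ℝ) (μ : Fin d) : ∑ x : Site d L, f (x.shift μ) = ∑ x : Site d L, f x :=
  Equiv.sum_comp (Equiv.addRight (Pi.single μ (1 : ZMod L) : Site d L)) f

/-- **Re-indexing**: the plaquette-by-plaquette derivative equals `∑_e Re tr (X_e Ω_e)` (every (link, plaquette ∋ link)
pair is counted once on each side). [folklore] -/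
theorem sum_plaquette_terms_eq (V : GaugeConfig d L SU[n]) :
    ∑ p : Plaquette d L, (upTerm V p.1 p.2.1.1 p.2.1.2 + loTerm V (p.1.shift p.2.1.1) p.2.1.2 p.2.1.1 +
        loTerm V (p.1.shift p.2.1.2) p.2.1.1 p.2.1.2 + upTerm V p.1 p.2.1.2 p.2.1.1) =
      ∑ e : Edge d L, (Xf V e * plaquetteLoopSum V e.1 e.2).trace.re := by
  rw [Fintype.sum_prod_type, Fintype.sum_prod_type]
  simp only [re_trace_Xf_mul_loopSum]
  have hx : ∀ x : Site d L, ∑ a, ∑ b, (if b = a then (0 : ℝ) else (upTerm V x a b + loTerm V x a b)) =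
      ∑ q : {q : Fin d × Fin d // q.1 < q.2}, (upTerm V x q.1.1 q.1.2 + upTerm V x q.1.2 q.1.1) +
        ∑ q : {q : Fin d × Fin d // q.1 < q.2}, (loTerm V x q.1.1 q.1.2 + loTerm V x q.1.2 q.1.1) := by
    intro x
    rw [sum_offDiag_eq_sum_lt, ← Finset.sum_add_distrib]
    exact Finset.sum_congr rfl fun q _ => by ring
  simp only [hx, Finset.sum_add_distrib]
  have hlo1 : ∑ x : Site d L, ∑ q : {q : Fin d × Fin d // q.1 < q.2}, loTerm V (x.shift q.1.1) q.1.2 q.1.1 =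
      ∑ x : Site d L, ∑ q : {q : Fin d × Fin d // q.1 < q.2}, loTerm V x q.1.2 q.1.1 := by
    rw [Finset.sum_comm, Finset.sum_comm (s := (Finset.univ : Finset (Site d L)))]
    exact Finset.sum_congr rfl fun q _ => sum_shift (fun x => loTerm V x q.1.2 q.1.1) q.1.1
  have hlo2 : ∑ x : Site d L, ∑ q : {q : Fin d × Fin d // q.1 < q.2}, loTerm V (x.shift q.1.2) q.1.1 q.1.2 =
      ∑ x : Site d L, ∑ q : {q : Fin d × Fin d // q.1 < q.2}, loTerm V x q.1.1 q.1.2 := by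
    rw [Finset.sum_comm, Finset.sum_comm (s := (Finset.univ : Finset (Site d L)))]
    exact Finset.sum_congr rfl fun q _ => sum_shift (fun x => loTerm V x q.1.1 q.1.2) q.1.2
  rw [hlo1, hlo2]
  simp only [← Finset.sum_add_distrib]
  exact Finset.sum_congr rfl fun x _ => Finset.sum_congr rfl fun q _ => by ring

/-- The gradient-flow identity `Re tr (P(W) W) = −Re tr (P(W)ᴴ P(W))` (the Hermitian part of `W` and the scalar part are
`Re tr`-orthogonal to the anti-Hermitian traceless `P(W)`). [folklore] -/
theorem re_trace_suProj_mul (W : Matrix (Fin n) (Fin n) ℂ) :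
    (suProj W * W).trace.re = -((suProj W)ᴴ * suProj W).trace.re := by
  set P := suProj W with hP
  have hskew : Pᴴ = -P := conjTranspose_suProj W
  have htr : P.trace = 0 := trace_suProj W
  set H : Matrix (Fin n) (Fin n) ℂ := (1 / 2 : ℂ) • (W + Wᴴ) with hH
  set c : ℂ := (1 / (2 * n) : ℂ) * (W - Wᴴ).trace with hc
  have hdec : W = P + (H + c • (1 : Matrix (Fin n) (Fin n) ℂ)) := by
    simp only [hP, suProj, hH, hc, smul_sub, smul_add]
    module
  have hHh : Hᴴ = H := by
    have h2 : star (1 / 2 : ℂ) = 1 / 2 := by norm_num [Complex.ext_iff]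
    rw [hH, Matrix.conjTranspose_smul, Matrix.conjTranspose_add, Matrix.conjTranspose_conjTranspose, add_comm, h2]
  have hherm : (P * H).trace.re = 0 := by
    have key : star (P * H).trace = -(P * H).trace := by
      rw [← Matrix.trace_conjTranspose, Matrix.conjTranspose_mul, hHh, hskew, Matrix.mul_neg, Matrix.trace_neg,
        Matrix.trace_mul_comm]
    have h := congrArg Complex.re key
    rw [Complex.star_def, Complex.conj_re, Complex.neg_re] at h
    linarith
  have hscal : (P * (c • (1 : Matrix (Fin n) (Fin n) ℂ))).trace.re = 0 := by
    rw [Matrix.mul_smul, Matrix.mul_one, Matrix.trace_smul, htr, smul_zero, Complex.zero_re]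
  have hPP : (P * P).trace.re = -((Pᴴ * P).trace.re) := by
    rw [hskew, Matrix.neg_mul, Matrix.trace_neg, Complex.neg_re, neg_neg]
  calc (P * W).trace.re = (P * (P + (H + c • (1 : Matrix (Fin n) (Fin n) ℂ)))).trace.re := by rw [← hdec]
    _ = (P * P).trace.re + (P * H).trace.re + (P * (c • (1 : Matrix (Fin n) (Fin n) ℂ))).trace.re := by
        rw [Matrix.mul_add, Matrix.mul_add, Matrix.trace_add, Matrix.trace_add, Complex.add_re, Complex.add_re, add_assoc]
    _ = -((Pᴴ * P).trace.re) := by rw [hherm, hscal, hPP, add_zero, add_zero]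

open scoped ComplexOrder in
/-- `Re tr (Aᴴ A) ≥ 0`. [folklore] -/
theorem re_trace_conjTranspose_mul_self_nonneg (A : Matrix (Fin n) (Fin n) ℂ) : 0 ≤ (Aᴴ * A).trace.re := by
  have h : 0 ≤ (Aᴴ * A).trace := (Matrix.posSemidef_conjTranspose_mul_self A).trace_nonneg
  exact (Complex.nonneg_iff.mp h).1

end WilsonFlow

/-! ### Monotonicity of the Wilson action (gradient flow) -/

/-- **The flow is the gradient flow of the Wilson action**: along `V_t = wilsonFlow t U`,
`d/dt S_W(V_t) = −∑_e Re tr (P(Ω_e(V_t))ᴴ P(Ω_e(V_t))) = −∑_e ‖P(Ω_e(V_t))‖²_F` for the tree's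
`wilsonAction (fundamentalRep (Fin n))` (sum over unoriented plaquettes; Lüscher's `g₀² S_w` is twice it).
[cite: Luscher2010Trivializing, eq. (4.30)] -/
theorem hasDerivAt_wilsonAction_wilsonFlow (U : GaugeConfig d L SU[n]) (t : ℝ) :
    HasDerivAt (fun s => wilsonAction (QuantumLattice.fundamentalRep (Fin n)) (wilsonFlow s U))
      (-(∑ e : Edge d L, ((suProj (plaquetteLoopSum (wilsonFlow t U) e.1 e.2))ᴴ *
          suProj (plaquetteLoopSum (wilsonFlow t U) e.1 e.2)).trace.re)) t := by
  refine (hasDerivAt_wilsonAction_wilsonFlow_plaquettes U t).congr_deriv ?_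
  rw [sum_plaquette_terms_eq, ← Finset.sum_neg_distrib]
  exact Finset.sum_congr rfl fun e _ => re_trace_suProj_mul _

/-- `d/dt S_W(V_t) ≤ 0`. [cite: Luscher2010Trivializing, eq. (4.30)] -/
theorem deriv_wilsonAction_wilsonFlow_nonpos (U : GaugeConfig d L SU[n]) (t : ℝ) :
    deriv (fun s => wilsonAction (QuantumLattice.fundamentalRep (Fin n)) (wilsonFlow s U)) t ≤ 0 := by
  rw [(hasDerivAt_wilsonAction_wilsonFlow U t).deriv, neg_nonpos]
  exact Finset.sum_nonneg fun e _ => re_trace_conjTranspose_mul_self_nonneg _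

/-- **Monotonicity**: "the action `S_w(V_t)` is a monotonically decreasing function of `t`" — `t ↦ S_W(wilsonFlow t U)` is
antitone on `ℝ`. [cite: Luscher2010, §1, after eq. (1.4)] -/
theorem antitone_wilsonAction_wilsonFlow (U : GaugeConfig d L SU[n]) :
    Antitone fun t => wilsonAction (QuantumLattice.fundamentalRep (Fin n)) (wilsonFlow t U) :=
  antitone_of_deriv_nonpos (fun t => (hasDerivAt_wilsonAction_wilsonFlow U t).differentiableAt)
    fun t => deriv_wilsonAction_wilsonFlow_nonpos U t

/-- The flowed action never exceeds the initial one: `S_W(V_t U) ≤ S_W(U)` for `t ≥ 0`. [cite: Luscher2010, §1] -/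
theorem wilsonAction_wilsonFlow_le (U : GaugeConfig d L SU[n]) {t : ℝ} (ht : 0 ≤ t) :
    wilsonAction (QuantumLattice.fundamentalRep (Fin n)) (wilsonFlow t U) ≤
      wilsonAction (QuantumLattice.fundamentalRep (Fin n)) U := by
  simpa only [wilsonFlow_zero] using antitone_wilsonAction_wilsonFlow U ht

end API

end Literature.MathematicalPhysics.QuantumFieldTheory
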